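import Literature.MathematicalPhysics.QuantumFieldTheory.Balaban1983to89.B3Op116MixedSeed
import Literature.MathematicalPhysics.QuantumFieldTheory.Balaban1983to89.B3Op116RegionSources

/-!
# Bałaban, *(Higgs)₂,₃ quantum fields in a finite volume III. Renormalization* [B3] — the kernel of the operator (1.16) p. 414 ON A
REGION `Ω`: THE MIXED SEED.  The region twin of p40's `B3Op116MixedSeed`: the difference `W = G_k(Ω,Ã+B̃) − G_k(Ω,B̃) =
G_k(Ω,B̃)V_k(Ã,B̃)G_k(Ω,Ã+B̃)` ((I.3.44)) on a dipole source `dip^B_{b′}Y` at an INTERIOR bond `b′`, read through one covariant derivative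
`D^ε_B` at an INTERIOR row bond `b₀`, obeys the single-exponent majorant bound of a once-differentiated column times the small factor
`|e|s·K₁ + L^k|e|δ_A·K₂`, with THE SAME constants `seedK1`, `seedK2` as on the torus — under print's support hypothesis p. 412
«dist(supp Ã, ∂Ω) > 2r(L^kε)» in the form `Ã_b ≠ 0 ⇒ b₋, b₊ deep` (file R1 `B3Op116RegionSources.DeepBlk`), which puts every bond source of
`V_k(Ã,B̃)` at interior points, where alone the (2.10) bounds of `G_k(Ω,·)` ([B4] Theorem p. 573, r14's carrier `regRegionKernels`) are available.

statement-level skeleton of published theorems with citation tags; proofs where landed; nothing here is a claim about the Yang–Mills mass gap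

T. Bałaban, Commun. Math. Phys. **88** (1983) 411–445 [cite: Balaban1983Higgs3]; part I, Commun. Math. Phys. **85** (1982) 603–636
[cite: Balaban1982Higgs1]; [B4] Commun. Math. Phys. **89** (1983) 571–597 [cite: Balaban1983RegularityDecay].  PDFs held:
`paper:balaban1983-higgs-2-3-quantum-fields-finite-volume` (journal page = PDF page + 410; p. 412 = `p0002.txt`, p. 414 = `p0004.txt`,
p. 424 = `p0014.txt`, p. 426 = `p0016.txt`), `paper:balaban1982-cmp85-higgs23-i` (p. 605 = `p0003.txt`, p. 610 = `p0008.txt`, pp. 614–615 =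
`p0012.txt`–`p0013.txt`, p. 619 = `p0017.txt`), `paper:balaban1983-cmp89-regularity-decay` (p. 573 = `p0003.txt`).

CITATION HEADER (lean-in-tree rule).  Cell `lit-balaban` (HOME `run/shared/lean/pub/lit-balaban/`), Phase-2 proof seat **p40** gen 75
(unit `lit-balaban-p40`); TAKING line HOME/STATUS 2026-08-23T09:21Z (B3-CLOSURE.md §5 item 20: the REGION twin of the (1.16) branch of
(2.5); owner r15's welcome 09:22Z; p35 g23 keeps the Hölder twin).  SKELETON rows **B3.Eq1.16** / **B3.Eq2.5** (fold owner r15; decl of record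
`B3Sect2StatementsPart2.ScaledKernels.Ineq25At`, the `hM` slot of p40's general-`Ω` assembly `B3Ineq25Op116Smooth.ineq25At_op116_smooth_of_bounds`)
— a located member (no head claim).  This is file R4a of the region programme (R1 `B3Op116RegionSources`, R2 `B3Op116DKernelRegularRegion`,
R4b `B3Op116MixedKernelRegularRegion`, R5 the region assembly).  USED BY NAME, never restated: the torus file `B3Op116MixedSeed` (§1 linearity
`map_srcV_univ`, `srcMD_sum`, `srcDM_sum`; §5 conversions; §6.1 the four arithmetic lemmas `md_arith`, `dm_arith`, `mm_arith`, `avg_arith` and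
the constants `kC`, `gE`, `seedK1`, `seedK2`; `dip_eq_dip_add_single`, `norm_U_sub_U_add_le`, `mul_sumS_eq_maj`), the engine `B3Op116OrderedPairs`
(`pair_bond_le`, `sum_sq_le_of_cases`, `sum_lower_pair_le`, `bump_shift_le(')`, `mesh_rpow_zero_sub`, `norm_pieceR_dip_apply_le`,
`block_avg_majorant_le`, `norm_fOne_apply_le_of_abs_le`), file R1 `B3Op116RegionSources` (`DeepBlk`, the vanishing lemmas, `srcV_region_eq_univ`,
`cutV`, `cutK`, `norm_mapE_avgSrc_region_le`, `mulM_eq_zero`), p35's `B3Op116LeibnizRows` (A′ `inv_smul_sum_srcDM_eq`, A″ `sum_srcMD_eq`, `nMul`,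
`norm_nMul_apply_le`, `reg_neg`, `norm_fOne_neg_apply_le`) and `B3Op116MajorantStep.maj`, r14's `B3Op116SourceForm` (THEOREM A `opV_apply_eq_srcV`
for every `Ω`, `srcMD/srcDM/srcMM/avgSrc/srcV`, `covDerivAt`, `norm_mapE_single_le`, `norm_mapE_dip_le`, `norm_mapE_srcMD/DM/MM_le`,
`inner_propagatorK_dip_apply`), `B3Op116KernelRegularTorus` (`col_le_of_ineq210`, `dcol_le_of_ineq210`, `norm_covDeriv_le_add_split`,
`majorant_shift_le(')`, `majorant_mono`, `top_bump_le_majorant_succ`), `B3Ineq210RegularRegion` (`pieceR`, `sum_pieceR`, `regRegionKernels`,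
`Interior`, `scaleR_eq`), `B3Eq116TwoSidedExpansion.eq344_model` (every `Ω`), p33's `B3Op116MajorantConvolution` (`sum_kernel_mul_le`,
`sum_bond_kernel_mul_le`) and `B3Ineq210MixedRegularRegion.mixedTermR`, p40's `B3Op116Pieces` and `B3Ineq210MixedRegularTorus` (`dip`, `onb`,
`norm_covDeriv_apply_single_le`), r15's carrier predicate `B3Sect2StatementsPart2.ScaledKernels.Ineq210`.

## What is printed

[B3] p. 412 [PDF 2] (verbatim): *"we will assume that |A|, |∂A|, |∂B| … ≤ O(1)p(L^kε) and dist(supp A, ∂Ω) > 2r(L^kε)"*.  p. 414 [PDF 4]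
(verbatim): *"for n, n′ sufficiently large, a kernel of the operator (1.16) is a sufficiently regular function of both variables. More
exactly the Hölder norms of the covariant derivatives of this kernel … are exponentially decaying with the distance of the arguments and are
uniformly bounded by O(1)(e(L^kε)^{1−α})^{n+n′} … This estimate follows easily from the properties of the propagators G_k(Ω, A) proved in
the next paper."*  [B4] Theorem p. 573 [PDF 3]: (1.9)/(1.10) for `G_k(Ω,A)` at points with `dist({x,x′},Ωᶜ) ≥ R₀` (all points only for
parallelepipeds).  [B3] p. 424 (2.6), p. 426 (2.10) (verbatim): *"|G^η_{(j)}(Ω, B̃; x, x′)| ≤ O(1)(L^jη)^{−d+2}e^{−δ₁(L^jη)^{−1}|x−x′|}, (2.10) and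
if the propagator is differentiated, then for each differentiation, there is an additional factor (L^jη)^{−1} on the right side."*  [B1]
p. 615 (3.16) (the bracket `V_k`), p. 619 (3.44).

## What this file proves, and how

The torus file line by line, with every column / differentiated column / twice-differentiated kernel of a piece of `G_k(Ω,·)` read at
INTERIOR pairs only (§1, from r15's `Ineq210` on r14's region carrier and from p33's `mixedTermR` bound at interior pairs), and every bond
sum TRUNCATED TO THE DEEP BONDS: the per-bond majorants are `1_[b₋ deep]·(…)`; on a bond that is not deep the three charges of `V_k(Ã,B̃)`
and the Leibniz charges of THEOREM A′/A″ vanish (file R1), on a deep bond both endpoints are interior and the torus estimate applies verbatim.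
§2 the four pair bounds (`md_direct_le_region`, `md_parts_le_region`, `dm_direct_le_region`, `dm_parts_le_region`) with the torus right
sides; §3 the scale-pair sums (`md_sum_le_region`, `dm_sum_le_region`); §4 the `M^*M` and averaging sources (`mm_le_region`, `avg_le_region`:
file R1's `norm_mapE_avgSrc_region_le` with `cutV`/`cutK`, the engine's `block_avg_majorant_le` on `cutV w`); §5 **THE ROW THEOREM ON A
REGION** `phi_row_srcV_le_region` (same constants `seedK1`, `seedK2`; the field pieces need their single-scale bounds at interior points
only); §6 the instances: `pdcol_cross_bound_region` (the `M_b`-term only where `Ã_b ≠ 0`, where `b₊` is deep), `norm_pieceR_dipB_le_region`,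
`norm_covDeriv_pieceR_dipB_le_region` (the charge `U(−B_{b′})Y − U(−(Ã+B̃)_{b′})Y` at `b′₊` vanishes unless `Ã_{b′} ≠ 0`, where `b′₊` is deep),
**`mixed_seed_le_region`**, `deriv_W_single_le_region`, the symmetry of `W` on every `Ω` (`inner_W_dip_apply`, `norm_W_dip_apply_le`),
`value_W_dip_le_region`, and **`mixed_seed_state_region`**: for an interior dipole bond `b′`, `φ = [G_k(Ω,Ã+B̃) − G_k(Ω,B̃)]dip^B_{b′}Y` has
`‖φ(x)‖ ≤ 𝔪_k(cv₀,2;δ₁/(4L))(x,b′₋)` at interior `x` and `‖(D^ε_Bφ)(b₀)‖ ≤ 𝔪_k(cd₀,1;δ₁/(4L))(b₀₋,b′₋)` at bonds from interior `b₀₋`, with the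
torus constants `cv₀, cd₀` — the seed of file R2's region induction for the mixed entry (file R4b).

## Honest scope

Regions `Ω ⊆ T_ε` for which the (2.10) bounds of `G_k(Ω,B̃)`, `G_k(Ω,Ã+B̃)` hold at `Interior k K₀ Ω` pairs in r15's shape `Ineq210 δ₁ C` on
r14's carrier (same `K₀` for both) together with the twice-differentiated per-piece bound in the shape of the conclusion of p33's
`ineq210_mixed_regularRegion` with a constant `C_M` — HYPOTHESES here (discharged for big-block unions and small regular backgrounds by r14's
`ineq210_regularRegion_small` and p33's theorem, not re-proved); `Ã = A` small (`|A_b| ≤ s`), (I.2.23)-regular (`δ_A`) and SUPPORTED ON DEEP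
BONDS (`A_b ≠ 0 ⇒ DeepBlk b₋ ∧ DeepBlk b₊` — print's «dist(supp Ã, ∂Ω) > 2r(L^kε)», p. 412, in r14's `R₀`-vocabulary); `(L^kε)|e|s ≤ 1`,
`m² > 0`, `a > 0`, `1 ≤ k ≤ K`, `0 < δ₁ ≤ 1`; every `d ≥ 1`, `L ≥ 2`, `N`.  Conclusions at interior points / bonds from interior points only
(nothing is claimed in the `R₀`-collar, exactly as in [B4]).  Constants explicit, not optimized, identical to the torus file's.  No `def` at
all; no `def … : Prop`, no new named fact; no `sorry`; axioms standard.  Value = the located non-bookkeeping step of a by-reference estimate of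
B3 at print's generality (regions), NOT summit progress.
-/


noncomputable section

open scoped BigOperators InnerProductSpace

namespace Literature.MathematicalPhysics.QuantumFieldTheory.Balaban1983to89.B3Op116MixedSeedRegion

open HiggsLattice (ChargeData ScalarField siteInner covDeriv)
open HiggsCovariance (propagatorK E)
open B1Eq230FluctCov (Ix cb)
open B1Ineq234Concrete (nCol)
open B1Ineq234LevelZero (tdist_comm)
open B3Ineq210RegularRegion (regRegionKernels Interior sum_pieceR scaleR_eq pieceR)
open B3Op116Pieces (mulM fOne norm_U_apply covDeriv_add_split)
open B3Op116ScaleChains (rate_eq mesh_rpow_add)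
open B3Op116MajorantConvolution (majorant_nonneg bump_mono_rate sum_kernel_mul_le sum_bond_kernel_mul_le)
open B3Op116SourceForm (mulMT srcMD srcDM srcMM avgSrc srcV covDerivAt covDerivAt_apply norm_mapE_srcMD_le norm_mapE_srcDM_le
  norm_mapE_srcMM_le norm_mapE_single_le norm_mapE_dip_le)
open B3Op116KernelRegularTorus (col_le_of_ineq210 dcol_le_of_ineq210 norm_covDeriv_le_add_split majorant_shift_le majorant_shift_le'
  majorant_mono top_bump_le_majorant_succ)
open B3Op116OrderedPairs (pair_bond_le sum_sq_le_of_cases sum_lower_pair_le bump_shift_le bump_shift_le' mesh_rpow_zero_sub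
  norm_pieceR_dip_apply_le block_avg_majorant_le norm_fOne_apply_le_of_abs_le mesh_rpow_mul_inv_pow_eq)
open B3Op116LeibnizRows (nMul pred norm_nMul_apply_le reg_neg norm_fOne_neg_apply_le sum_srcMD_eq inv_smul_sum_srcDM_eq)
open B3Op116MixedSeed (map_srcV_univ srcMD_sum srcDM_sum mesh_one_mul_rpow_mul_inv mesh_rpow_mul_one_mul_inv mesh_rpow_mul_zero_mul_inv
  kC gE seedK1 seedK2 md_arith dm_arith mm_arith avg_arith dip_eq_dip_add_single norm_U_sub_U_add_le mul_sumS_eq_maj)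
open B3Op116RegionSources (DeepBlk mulM_eq_zero srcMD_eq_zero srcDM_eq_zero srcMM_eq_zero nMul_eq_zero apply_eq_zero_of_not_deep_src
  apply_pred_eq_zero_of_not_deep_src leibnizCharge_eq_zero srcV_region_eq_univ cutV cutK cutV_nonneg cutK_nonneg cutV_le_of cutK_le_of
  cutV_of_interior cutK_of_interior norm_mapE_avgSrc_region_le)
open HiggsCovariancePos (Inside)
open B3Ineq210MixedRegularTorus (dip onb dip_zero)
open B3Ineq210MixedRegularRegion (mixedTermR)
open HiggsAveraging (blockIter blockK)

variable {P : HiggsLattice.Params} {N : ℕ}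

/-- a single-scale bump with a nonnegative constant is nonnegative. [cite: Balaban1983Higgs3, (2.10) p.426] -/
private theorem bump_nonneg {c : ℝ} (hc : 0 ≤ c) (j : ℕ) (e t : ℝ) : 0 ≤ c * P.mesh j ^ e * Real.exp t :=
  mul_nonneg (mul_nonneg hc (Real.rpow_nonneg (P.mesh_pos j).le e)) (Real.exp_nonneg _)

/-! ## §1 The pieces of `G_k(Ω,X)` at INTERIOR pairs: columns, differentiated columns, twice-differentiated kernels -/

section Dictionary

variable {C : ChargeData N} {B X : HiggsLattice.VecField P 0} {msq a : ℝ} {k K₀ : ℕ} {hL1 : 1 < P.L} {δ₁ Cst CM : ℝ}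
  {Ω : Finset (HiggsLattice.Site P 0)}

/-- The row functional `Φ_j = D^ε_B(·)(b₀) ∘ G^η_{(j)}(Ω,B)` of a region piece, unfolded. [cite: Balaban1983Higgs3, (2.6) p.424] -/
theorem phiR_apply (b₀ : HiggsLattice.PBond P 0) (j : ℕ) (f : ScalarField P 0 N) :
    (covDerivAt C B b₀ ∘ₗ pieceR C Ω B msq a k j) f = covDeriv C B (pieceR C Ω B msq a k j f) b₀ := rfl

/-- **(2.10) for one piece of `G_k(Ω,X)`, value, at an interior pair**: `Σ_i‖(G^η_{(j)}(Ω,X)e_{(y,i)})(x)‖ ≤ ε^dC(L^jε)^{2−d}e^{−δ₁(L^jε)^{−1}ε|x−y|}`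
from r15's carrier predicate on r14's region carrier. [cite: Balaban1983Higgs3, (2.10) p.426] [cite: Balaban1983RegularityDecay, Theorem p.573] -/
theorem pcolR_le (h210 : (regRegionKernels hL1 C Ω X msq a k K₀).Ineq210 δ₁ Cst) (j : ℕ) {x y : HiggsLattice.Site P 0}
    (hx : Interior k K₀ Ω x) (hy : Interior k K₀ Ω y) :
    ∑ i : Ix N, ‖pieceR C Ω X msq a k j (cb P N 0 (y, i)) x‖ ≤ (P.mesh 0 ^ P.d * Cst) * P.mesh j ^ ((2 : ℝ) - (P.d : ℝ)) *
        Real.exp (-(δ₁ * (P.mesh j)⁻¹ * (P.mesh 0 * (HiggsLattice.Site.tdist x y : ℝ)))) := by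
  have hm : 0 < P.mesh 0 ^ P.d := pow_pos (P.mesh_pos 0) _
  have h := (h210 j ⟨x, hx⟩ ⟨y, hy⟩).1
  have e1 : (regRegionKernels hL1 C Ω X msq a k K₀).absG j ⟨x, hx⟩ ⟨y, hy⟩
      = (P.mesh 0 ^ P.d)⁻¹ * ∑ i : Ix N, ‖pieceR C Ω X msq a k j (cb P N 0 (y, i)) x‖ := rfl
  have e3 : (regRegionKernels hL1 C Ω X msq a k K₀).dist ⟨x, hx⟩ ⟨y, hy⟩ = P.mesh 0 * (HiggsLattice.Site.tdist x y : ℝ) := rfl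
  have e4 : (regRegionKernels hL1 C Ω X msq a k K₀).d = P.d := rfl
  rw [scaleR_eq, e1, e3, e4, inv_mul_le_iff₀ hm] at h
  refine h.trans (le_of_eq ?_)
  ring

/-- **(2.10) for one piece of `G_k(Ω,X)`, one derivative** (in the piece's own background), at an interior pair:
`Σ_i‖(D^ε_XG^η_{(j)}(Ω,X)e_{(y,i)})(b)‖ ≤ ε^dC(L^jε)^{1−d}e^{−δ₁(L^jε)^{−1}ε|b₋−y|}`. [cite: Balaban1983Higgs3, (2.10) p.426] [cite: Balaban1983RegularityDecay, Theorem p.573] -/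
theorem pdcolR_le (h210 : (regRegionKernels hL1 C Ω X msq a k K₀).Ineq210 δ₁ Cst) (j : ℕ) {b : HiggsLattice.PBond P 0}
    {y : HiggsLattice.Site P 0} (hb : Interior k K₀ Ω b.src) (hy : Interior k K₀ Ω y) :
    ∑ i : Ix N, ‖covDeriv C X (pieceR C Ω X msq a k j (cb P N 0 (y, i))) b‖ ≤ (P.mesh 0 ^ P.d * Cst) * P.mesh j ^ ((1 : ℝ) - (P.d : ℝ)) *
        Real.exp (-(δ₁ * (P.mesh j)⁻¹ * (P.mesh 0 * (HiggsLattice.Site.tdist b.src y : ℝ)))) := by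
  have hm : 0 < P.mesh 0 ^ P.d := pow_pos (P.mesh_pos 0) _
  have h := (h210 j ⟨b.src, hb⟩ ⟨y, hy⟩).2 b.dir
  have e2 : (regRegionKernels hL1 C Ω X msq a k K₀).absDG j b.dir ⟨b.src, hb⟩ ⟨y, hy⟩
      = (P.mesh 0 ^ P.d)⁻¹ * ∑ i : Ix N, ‖covDeriv C X (pieceR C Ω X msq a k j (cb P N 0 (y, i))) b‖ := rfl
  have e3 : (regRegionKernels hL1 C Ω X msq a k K₀).dist ⟨b.src, hb⟩ ⟨y, hy⟩ = P.mesh 0 * (HiggsLattice.Site.tdist b.src y : ℝ) := rfl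
  have e4 : (regRegionKernels hL1 C Ω X msq a k K₀).d = P.d := rfl
  rw [scaleR_eq, e2, e3, e4, inv_mul_le_iff₀ hm] at h
  refine h.trans (le_of_eq ?_)
  ring

/-- **(2.10) for one piece of `G_k(Ω,X)`, twice differentiated** (row derivative and dipole in the piece's own background), at an interior
pair, in the majorant currency: `ε⁻¹Σ_i‖(D^ε_XG^η_{(j)}(Ω,X)dip^X_be_i)(b₀)‖ ≤ ε^dC_M(L^jε)^{0−d}e^{−δ₁(L^jε)^{−1}ε|b₀₋−b₋|}` from a bound of
p33's `mixedTermR` at interior pairs (the shape of the conclusion of `B3Ineq210MixedRegularRegion.ineq210_mixed_regularRegion`).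
[cite: Balaban1983Higgs3, (2.10) p.426] [cite: Balaban1983RegularityDecay, Theorem p.573] -/
theorem pmixR_le
    (hmix : ∀ (j : ℕ) (μ ν : Fin P.d) (x x' : HiggsLattice.Site P 0), Interior k K₀ Ω x → Interior k K₀ Ω x' →
      mixedTermR C Ω X msq a k j μ ν x x' ≤ CM * (P.mesh j ^ P.d)⁻¹ * Real.exp (-(δ₁ * ((HiggsLattice.Site.tdist x x' : ℝ) / (P.L : ℝ) ^ j))))
    (j : ℕ) {b₀ b : HiggsLattice.PBond P 0} (hb₀ : Interior k K₀ Ω b₀.src) (hb : Interior k K₀ Ω b.src) :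
    (P.mesh 0)⁻¹ * ∑ i : Ix N, ‖covDeriv C X (pieceR C Ω X msq a k j (dip C X b (onb N i))) b₀‖
      ≤ (P.mesh 0 ^ P.d * CM) * P.mesh j ^ ((0 : ℝ) - (P.d : ℝ)) *
        Real.exp (-(δ₁ * (P.mesh j)⁻¹ * (P.mesh 0 * (HiggsLattice.Site.tdist b₀.src b.src : ℝ)))) := by
  have hε : 0 < P.mesh 0 ^ P.d := pow_pos (P.mesh_pos 0) _
  have e : (P.mesh 0)⁻¹ * ∑ i : Ix N, ‖covDeriv C X (pieceR C Ω X msq a k j (dip C X b (onb N i))) b₀‖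
      = P.mesh 0 ^ P.d * mixedTermR C Ω X msq a k j b₀.dir b.dir b₀.src b.src := by
    unfold B3Ineq210MixedRegularRegion.mixedTermR
    rw [← mul_assoc, mul_inv_cancel₀ hε.ne', one_mul]
  rw [e, mesh_rpow_zero_sub, rate_eq, div_mul_eq_mul_div]
  have h := hmix j b₀.dir b.dir b₀.src b.src hb₀ hb
  calc P.mesh 0 ^ P.d * mixedTermR C Ω X msq a k j b₀.dir b.dir b₀.src b.src
      ≤ P.mesh 0 ^ P.d * (CM * (P.mesh j ^ P.d)⁻¹ *
          Real.exp (-(δ₁ * ((HiggsLattice.Site.tdist b₀.src b.src : ℝ) / (P.L : ℝ) ^ j)))) :=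
        mul_le_mul_of_nonneg_left h hε.le
    _ = _ := by rw [mul_div_assoc]; ring

variable (C msq a k)

/-- **(2.6) through one covariant derivative, on a region**: `(D^ε_YG_k(Ω,X)f)(b) = Σ_{j<k}(D^ε_YG^η_{(j)}(Ω,X)f)(b)`. [cite: Balaban1983Higgs3, (2.6) p.424] -/
theorem covDeriv_propagatorK_eq_sum_piecesR (Y X : HiggsLattice.VecField P 0) (hmsq : 0 < msq) (ha : 0 < a) (hL1 : 1 < P.L)
    (hk : 1 ≤ k) (hkK : k ≤ P.K) (f : ScalarField P 0 N) (b : HiggsLattice.PBond P 0) :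
    covDeriv C Y (propagatorK C Ω X msq a k f) b = ∑ j ∈ Finset.range k, covDeriv C Y (pieceR C Ω X msq a k j f) b := by
  rw [← sum_pieceR (C := C) (Ω := Ω) (A := X) (a := a) hmsq ha hL1 hk hkK, LinearMap.sum_apply, B3Ineq210RegularTorus.covDeriv_sum'']

/-- **(2.6) on a field, on a region**: `G_k(Ω,X)f = Σ_{j<k}G^η_{(j)}(Ω,X)f`. [cite: Balaban1983Higgs3, (2.6) p.424] -/
theorem propagatorK_apply_eq_sum_piecesR (X : HiggsLattice.VecField P 0) (hmsq : 0 < msq) (ha : 0 < a) (hL1 : 1 < P.L)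
    (hk : 1 ≤ k) (hkK : k ≤ P.K) (f : ScalarField P 0 N) :
    propagatorK C Ω X msq a k f = ∑ j ∈ Finset.range k, pieceR C Ω X msq a k j f := by
  rw [← sum_pieceR (C := C) (Ω := Ω) (A := X) (a := a) hmsq ha hL1 hk hkK, LinearMap.sum_apply]

end Dictionary

/-! ## §2 ONE PAIR OF SCALES on a region: the four pair bounds, the bond sums truncated to the deep bonds -/

section Pairs

open scoped Classical

variable {C : ChargeData N} {A B : HiggsLattice.VecField P 0} {msq a : ℝ} {k K₀ : ℕ} {hL1 : 1 < P.L} {δ₁ Cst CM s δA : ℝ}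
  {Ω : Finset (HiggsLattice.Site P 0)}

/-- `F₁(0) = 0`. [cite: Balaban1982Higgs1, (3.14) p.614] -/
private theorem fOne_zero' (C : ChargeData N) : fOne C (P.mesh 0) 0 = (0 : E N →L[ℝ] E N) := by
  ext v; simp [B3Op116Pieces.fOne_apply, ChargeData.U_zero]

/-- **PAIR BOUND 1 ON A REGION — the `M^*D` source, directly** (row bond `b₀` from an interior point; the field's derivative bound at bonds
from interior points; the sources of bonds that are not deep vanish): the torus right side of `B3Op116MixedSeed.md_direct_le`.
[cite: Balaban1983Higgs3, (1.16) p.414, (2.6) p.424, (2.10) p.426, p.412] [cite: Balaban1982Higgs1, (3.16) p.615] -/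
theorem md_direct_le_region (hδ₁ : 0 < δ₁) (hδ₁1 : δ₁ ≤ 1) (hCst : 0 ≤ Cst) (hs : 0 ≤ s)
    (h210B : (regRegionKernels hL1 C Ω B msq a k K₀).Ineq210 δ₁ Cst)
    (hA : ∀ b : HiggsLattice.PBond P 0, |A b| ≤ s)
    (hAS : ∀ b : HiggsLattice.PBond P 0, A b ≠ 0 → DeepBlk k K₀ Ω b.src ∧ DeepBlk k K₀ Ω b.tgt)
    (i₀ : Ix N) {b₀ : HiggsLattice.PBond P 0} (hb₀ : Interior k K₀ Ω b₀.src) (x' : HiggsLattice.Site P 0)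
    (j₁ j₂ : ℕ) (u : ScalarField P 0 N) {aw cu' : ℝ} (hcu' : 0 ≤ cu')
    (hud : ∀ b : HiggsLattice.PBond P 0, Interior k K₀ Ω b.src → ‖covDeriv C B u b‖ ≤ cu' * P.mesh j₁ ^ (aw - 1 - (P.d : ℝ)) *
      Real.exp (-(δ₁ * (P.mesh j₁)⁻¹ * (P.mesh 0 * (HiggsLattice.Site.tdist b.src x' : ℝ))))) :
    ‖covDeriv C B (pieceR C Ω B msq a k j₂ (∑ b : HiggsLattice.PBond P 0, srcMD C A B b u)) b₀‖
      ≤ (P.d : ℝ) * ((Real.exp 1 * (P.mesh 0 ^ P.d * Cst)) * (|C.e| * s * cu') *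
            ((nCol N : ℝ) * (8 * P.d / δ₁) ^ P.d * (P.mesh 0 ^ P.d)⁻¹)) *
          (P.mesh j₂ ^ (1 : ℝ) * P.mesh j₁ ^ (aw - 1) * (P.mesh (max j₂ j₁) ^ P.d)⁻¹) *
          Real.exp (-(δ₁ / 2 * (P.mesh (max j₂ j₁))⁻¹ * (P.mesh 0 * (HiggsLattice.Site.tdist b₀.src x' : ℝ)))) := by
  have hes : 0 ≤ |C.e| * s := mul_nonneg (abs_nonneg _) hs
  have hc : 0 ≤ P.mesh 0 ^ P.d * Cst := mul_nonneg (pow_nonneg (P.mesh_pos 0).le _) hCst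
  -- the per-bond majorants, truncated to the deep bonds
  set F : HiggsLattice.PBond P 0 → ℝ := fun b =>
    if DeepBlk k K₀ Ω b.src then ∑ i : Ix N, ‖covDeriv C B (pieceR C Ω B msq a k j₂ (cb P N 0 (b.tgt, i))) b₀‖ else 0 with hF
  set G : HiggsLattice.PBond P 0 → ℝ := fun b => if DeepBlk k K₀ Ω b.src then |C.e| * s * ‖covDeriv C B u b‖ else 0 with hG
  have hF0 : ∀ b, 0 ≤ F b := fun b => by
    simp only [hF]; split_ifs
    · exact Finset.sum_nonneg fun _ _ => norm_nonneg _
    · exact le_rfl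
  have hG0 : ∀ b, 0 ≤ G b := fun b => by
    simp only [hG]; split_ifs
    · exact mul_nonneg hes (norm_nonneg _)
    · exact le_rfl
  -- separate the bonds
  have step1 : ‖covDeriv C B (pieceR C Ω B msq a k j₂ (∑ b : HiggsLattice.PBond P 0, srcMD C A B b u)) b₀‖
      ≤ ∑ b : HiggsLattice.PBond P 0, F b * G b := by
    rw [map_sum, B3Ineq210RegularTorus.covDeriv_sum'']
    refine (norm_sum_le _ _).trans (Finset.sum_le_sum fun b _ => ?_)
    by_cases hb : DeepBlk k K₀ Ω b.src
    · simp only [hF, hG, if_pos hb]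
      have h := norm_mapE_srcMD_le C A B (covDerivAt C B b₀ ∘ₗ pieceR C Ω B msq a k j₂) (hA b) u
      simp only [phiR_apply] at h
      refine h.trans (le_of_eq ?_)
      ring
    · simp only [hF, hG, if_neg hb, mul_zero]
      rw [srcMD_eq_zero C A B (apply_eq_zero_of_not_deep_src A hAS hb), map_zero, B3Ineq210RegularTorus.covDeriv_zero'', norm_zero]
  refine step1.trans ?_
  refine pair_bond_le hδ₁ hδ₁1 j₂ j₁ (mul_nonneg (Real.exp_nonneg _) hc) (mul_nonneg hes hcu') i₀ b₀.src x' F G hF0 hG0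
    (fun b => ?_) (fun b => ?_)
  · by_cases hb : DeepBlk k K₀ Ω b.src
    · -- the differentiated column of the piece at the interior pair `(b₀₋, b₊)`, shifted from `b₊` to `b₋`
      simp only [hF, if_pos hb]
      refine (pdcolR_le h210B j₂ hb₀ (hb.interior_shift b.dir)).trans ?_
      have hsh := bump_shift_le hδ₁.le hδ₁1 j₂ b₀.src b.src b.dir
      have hm : 0 ≤ (P.mesh 0 ^ P.d * Cst) * P.mesh j₂ ^ ((1 : ℝ) - (P.d : ℝ)) := mul_nonneg hc (Real.rpow_nonneg (P.mesh_pos _).le _)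
      calc (P.mesh 0 ^ P.d * Cst) * P.mesh j₂ ^ ((1 : ℝ) - (P.d : ℝ)) *
            Real.exp (-(δ₁ * (P.mesh j₂)⁻¹ * (P.mesh 0 * (HiggsLattice.Site.tdist b₀.src b.tgt : ℝ))))
          ≤ (P.mesh 0 ^ P.d * Cst) * P.mesh j₂ ^ ((1 : ℝ) - (P.d : ℝ)) *
            (Real.exp 1 * Real.exp (-(δ₁ * (P.mesh j₂)⁻¹ * (P.mesh 0 * (HiggsLattice.Site.tdist b₀.src b.src : ℝ))))) :=
            mul_le_mul_of_nonneg_left hsh hm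
        _ = _ := by ring
    · simp only [hF, if_neg hb]
      exact bump_nonneg (mul_nonneg (Real.exp_nonneg _) hc) _ _ _
  · by_cases hb : DeepBlk k K₀ Ω b.src
    · simp only [hG, if_pos hb]
      exact (mul_le_mul_of_nonneg_left (hud b hb.interior) hes).trans (le_of_eq (by ring))
    · simp only [hG, if_neg hb]
      exact bump_nonneg (mul_nonneg hes hcu') _ _ _

/-- **PAIR BOUND 2 ON A REGION — the `M^*D` source in Leibniz form** (THEOREM A″; the field's VALUE at interior sites): the torus right side
of `B3Op116MixedSeed.md_parts_le`. [cite: Balaban1983Higgs3, (1.16) p.414, (2.6) p.424, (2.10) p.426, p.412] [cite: Balaban1982Higgs1, (2.23) p.610, (3.16) p.615] -/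
theorem md_parts_le_region (hδ₁ : 0 < δ₁) (hδ₁1 : δ₁ ≤ 1) (hCst : 0 ≤ Cst) (hCM : 0 ≤ CM) (hs : 0 ≤ s) (hδA : 0 ≤ δA)
    (h210B : (regRegionKernels hL1 C Ω B msq a k K₀).Ineq210 δ₁ Cst)
    (hmixB : ∀ (j : ℕ) (μ ν : Fin P.d) (x x' : HiggsLattice.Site P 0), Interior k K₀ Ω x → Interior k K₀ Ω x' →
      mixedTermR C Ω B msq a k j μ ν x x' ≤ CM * (P.mesh j ^ P.d)⁻¹ * Real.exp (-(δ₁ * ((HiggsLattice.Site.tdist x x' : ℝ) / (P.L : ℝ) ^ j))))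
    (hA : ∀ b : HiggsLattice.PBond P 0, |A b| ≤ s)
    (hreg : ∀ (z : HiggsLattice.Site P 0) (μ ν : Fin P.d), |A ⟨z.shift ν, μ⟩ - A ⟨z, μ⟩| ≤ δA)
    (hAS : ∀ b : HiggsLattice.PBond P 0, A b ≠ 0 → DeepBlk k K₀ Ω b.src ∧ DeepBlk k K₀ Ω b.tgt)
    (i₀ : Ix N) {b₀ : HiggsLattice.PBond P 0} (hb₀ : Interior k K₀ Ω b₀.src) (x' : HiggsLattice.Site P 0) (j₁ j₂ : ℕ)
    (u : ScalarField P 0 N) {aw cu : ℝ} (hcu : 0 ≤ cu)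
    (huv : ∀ y : HiggsLattice.Site P 0, Interior k K₀ Ω y → ‖u y‖ ≤ cu * P.mesh j₁ ^ (aw - (P.d : ℝ)) *
      Real.exp (-(δ₁ * (P.mesh j₁)⁻¹ * (P.mesh 0 * (HiggsLattice.Site.tdist y x' : ℝ))))) :
    ‖covDeriv C B (pieceR C Ω B msq a k j₂ (∑ b : HiggsLattice.PBond P 0, srcMD C A B b u)) b₀‖
      ≤ (P.d : ℝ) * ((P.mesh 0 ^ P.d * Cst) * ((P.mesh 0)⁻¹ * (|C.e| * δA) * cu) *
            ((nCol N : ℝ) * (8 * P.d / δ₁) ^ P.d * (P.mesh 0 ^ P.d)⁻¹)) *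
          (P.mesh j₂ ^ (1 : ℝ) * P.mesh j₁ ^ aw * (P.mesh (max j₂ j₁) ^ P.d)⁻¹) *
          Real.exp (-(δ₁ / 2 * (P.mesh (max j₂ j₁))⁻¹ * (P.mesh 0 * (HiggsLattice.Site.tdist b₀.src x' : ℝ))))
        + (P.d : ℝ) * ((P.mesh 0 ^ P.d * CM) * (|C.e| * s * cu) *
            ((nCol N : ℝ) * (8 * P.d / δ₁) ^ P.d * (P.mesh 0 ^ P.d)⁻¹)) *
          (P.mesh j₂ ^ (0 : ℝ) * P.mesh j₁ ^ aw * (P.mesh (max j₂ j₁) ^ P.d)⁻¹) *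
          Real.exp (-(δ₁ / 2 * (P.mesh (max j₂ j₁))⁻¹ * (P.mesh 0 * (HiggsLattice.Site.tdist b₀.src x' : ℝ)))) := by
  have hε := P.mesh_pos 0
  have hes : 0 ≤ |C.e| * s := mul_nonneg (abs_nonneg _) hs
  have hN : 0 ≤ (P.mesh 0)⁻¹ * (|C.e| * δA) := mul_nonneg (inv_nonneg.mpr hε.le) (mul_nonneg (abs_nonneg _) hδA)
  have hc : 0 ≤ P.mesh 0 ^ P.d * Cst := mul_nonneg (pow_nonneg hε.le _) hCst
  have hcM : 0 ≤ P.mesh 0 ^ P.d * CM := mul_nonneg (pow_nonneg hε.le _) hCM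
  -- the per-bond majorants, truncated to the deep bonds
  set F₁ : HiggsLattice.PBond P 0 → ℝ := fun b =>
    if DeepBlk k K₀ Ω b.src then ∑ i : Ix N, ‖covDeriv C B (pieceR C Ω B msq a k j₂ (cb P N 0 (b.src, i))) b₀‖ else 0 with hF₁
  set G₁ : HiggsLattice.PBond P 0 → ℝ := fun b =>
    if DeepBlk k K₀ Ω b.src then (P.mesh 0)⁻¹ * (|C.e| * δA) * ‖u b.src‖ else 0 with hG₁
  set F₂ : HiggsLattice.PBond P 0 → ℝ := fun b =>
    if DeepBlk k K₀ Ω b.src then (P.mesh 0)⁻¹ * ∑ i : Ix N, ‖covDeriv C B (pieceR C Ω B msq a k j₂ (dip C B b (onb N i))) b₀‖ else 0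
    with hF₂
  set G₂ : HiggsLattice.PBond P 0 → ℝ := fun b => if DeepBlk k K₀ Ω b.src then |C.e| * s * ‖u b.src‖ else 0 with hG₂
  have hF₁0 : ∀ b, 0 ≤ F₁ b := fun b => by
    simp only [hF₁]; split_ifs
    · exact Finset.sum_nonneg fun _ _ => norm_nonneg _
    · exact le_rfl
  have hG₁0 : ∀ b, 0 ≤ G₁ b := fun b => by
    simp only [hG₁]; split_ifs
    · exact mul_nonneg hN (norm_nonneg _)
    · exact le_rfl
  have hF₂0 : ∀ b, 0 ≤ F₂ b := fun b => by
    simp only [hF₂]; split_ifs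
    · exact mul_nonneg (inv_nonneg.mpr hε.le) (Finset.sum_nonneg fun _ _ => norm_nonneg _)
    · exact le_rfl
  have hG₂0 : ∀ b, 0 ≤ G₂ b := fun b => by
    simp only [hG₂]; split_ifs
    · exact mul_nonneg hes (norm_nonneg _)
    · exact le_rfl
  -- THEOREM A″ and the two resulting bond sums
  have step1 : ‖covDeriv C B (pieceR C Ω B msq a k j₂ (∑ b : HiggsLattice.PBond P 0, srcMD C A B b u)) b₀‖
      ≤ (∑ b : HiggsLattice.PBond P 0, F₁ b * G₁ b) + ∑ b : HiggsLattice.PBond P 0, F₂ b * G₂ b := by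
    rw [← phiR_apply, sum_srcMD_eq, map_add, map_neg, map_smul, map_sum, map_sum, Finset.smul_sum]
    simp only [phiR_apply]
    refine (norm_add_le _ _).trans ?_
    rw [norm_neg, add_comm]
    refine add_le_add ?_ ?_
    · refine (norm_sum_le _ _).trans (Finset.sum_le_sum fun b _ => ?_)
      by_cases hb : DeepBlk k K₀ Ω b.src
      · simp only [hF₁, hG₁, if_pos hb]
        have h := norm_mapE_single_le (covDerivAt C B b₀ ∘ₗ pieceR C Ω B msq a k j₂) b.src (nMul C (-A) b (u b.src))
        simp only [phiR_apply] at h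
        refine h.trans ?_
        rw [mul_comm]
        exact mul_le_mul_of_nonneg_left (norm_nMul_apply_le C (-A) (reg_neg A hreg) b _) (Finset.sum_nonneg fun _ _ => norm_nonneg _)
      · simp only [hF₁, hG₁, if_neg hb, mul_zero]
        have h1 : (-A) (pred b) = 0 := by rw [Pi.neg_apply, apply_pred_eq_zero_of_not_deep_src A hAS hb, neg_zero]
        have h2 : (-A) b = 0 := by rw [Pi.neg_apply, apply_eq_zero_of_not_deep_src A hAS hb, neg_zero]
        rw [nMul_eq_zero C (-A) h1 h2, _root_.zero_apply, Pi.single_zero, map_zero, B3Ineq210RegularTorus.covDeriv_zero'',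
          norm_zero]
    · refine (norm_sum_le _ _).trans (Finset.sum_le_sum fun b _ => ?_)
      rw [norm_smul, Real.norm_eq_abs, abs_of_pos (inv_pos.mpr hε)]
      by_cases hb : DeepBlk k K₀ Ω b.src
      · simp only [hF₂, hG₂, if_pos hb]
        have h := norm_mapE_dip_le C B (covDerivAt C B b₀ ∘ₗ pieceR C Ω B msq a k j₂) b (fOne C (P.mesh 0) (-(A b)) (u b.src))
        simp only [phiR_apply] at h
        calc (P.mesh 0)⁻¹ * ‖covDeriv C B (pieceR C Ω B msq a k j₂ (dip C B b (fOne C (P.mesh 0) (-(A b)) (u b.src)))) b₀‖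
            ≤ (P.mesh 0)⁻¹ * (‖fOne C (P.mesh 0) (-(A b)) (u b.src)‖ *
                ∑ i : Ix N, ‖covDeriv C B (pieceR C Ω B msq a k j₂ (dip C B b (onb N i))) b₀‖) :=
              mul_le_mul_of_nonneg_left h (inv_nonneg.mpr hε.le)
          _ = ((P.mesh 0)⁻¹ * ∑ i : Ix N, ‖covDeriv C B (pieceR C Ω B msq a k j₂ (dip C B b (onb N i))) b₀‖) *
                ‖fOne C (P.mesh 0) (-(A b)) (u b.src)‖ := by ring
          _ ≤ ((P.mesh 0)⁻¹ * ∑ i : Ix N, ‖covDeriv C B (pieceR C Ω B msq a k j₂ (dip C B b (onb N i))) b₀‖) *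
                (|C.e| * s * ‖u b.src‖) :=
              mul_le_mul_of_nonneg_left (norm_fOne_neg_apply_le C A (hA b) _)
                (mul_nonneg (inv_nonneg.mpr hε.le) (Finset.sum_nonneg fun _ _ => norm_nonneg _))
      · simp only [hF₂, hG₂, if_neg hb, mul_zero]
        rw [apply_eq_zero_of_not_deep_src A hAS hb, neg_zero, fOne_zero', _root_.zero_apply, dip_zero, map_zero,
          B3Ineq210RegularTorus.covDeriv_zero'', norm_zero, mul_zero]
  refine step1.trans (add_le_add ?_ ?_)
  · refine pair_bond_le hδ₁ hδ₁1 j₂ j₁ hc (mul_nonneg hN hcu) i₀ b₀.src x' F₁ G₁ hF₁0 hG₁0 (fun b => ?_) (fun b => ?_)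
    · by_cases hb : DeepBlk k K₀ Ω b.src
      · simp only [hF₁, if_pos hb]; exact pdcolR_le h210B j₂ hb₀ hb.interior
      · simp only [hF₁, if_neg hb]; exact bump_nonneg hc _ _ _
    · by_cases hb : DeepBlk k K₀ Ω b.src
      · simp only [hG₁, if_pos hb]
        exact (mul_le_mul_of_nonneg_left (huv b.src hb.interior) hN).trans (le_of_eq (by ring))
      · simp only [hG₁, if_neg hb]; exact bump_nonneg (mul_nonneg hN hcu) _ _ _
  · refine pair_bond_le hδ₁ hδ₁1 j₂ j₁ hcM (mul_nonneg hes hcu) i₀ b₀.src x' F₂ G₂ hF₂0 hG₂0 (fun b => ?_) (fun b => ?_)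
    · by_cases hb : DeepBlk k K₀ Ω b.src
      · simp only [hF₂, if_pos hb]; exact pmixR_le hmixB j₂ hb₀ hb.interior
      · simp only [hF₂, if_neg hb]; exact bump_nonneg hcM _ _ _
    · by_cases hb : DeepBlk k K₀ Ω b.src
      · simp only [hG₂, if_pos hb]
        exact (mul_le_mul_of_nonneg_left (huv b.src hb.interior) hes).trans (le_of_eq (by ring))
      · simp only [hG₂, if_neg hb]; exact bump_nonneg (mul_nonneg hes hcu) _ _ _

/-- **PAIR BOUND 3 ON A REGION — the `D^*M` source, directly** (the field's VALUE at the interior site `b₊` of a deep bond): the torus right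
side of `B3Op116MixedSeed.dm_direct_le`. [cite: Balaban1983Higgs3, (1.16) p.414, (2.6) p.424, (2.10) p.426, p.412] [cite: Balaban1982Higgs1, (3.16) p.615] -/
theorem dm_direct_le_region (hδ₁ : 0 < δ₁) (hδ₁1 : δ₁ ≤ 1) (hCM : 0 ≤ CM) (hs : 0 ≤ s)
    (hmixB : ∀ (j : ℕ) (μ ν : Fin P.d) (x x' : HiggsLattice.Site P 0), Interior k K₀ Ω x → Interior k K₀ Ω x' →
      mixedTermR C Ω B msq a k j μ ν x x' ≤ CM * (P.mesh j ^ P.d)⁻¹ * Real.exp (-(δ₁ * ((HiggsLattice.Site.tdist x x' : ℝ) / (P.L : ℝ) ^ j))))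
    (hA : ∀ b : HiggsLattice.PBond P 0, |A b| ≤ s)
    (hAS : ∀ b : HiggsLattice.PBond P 0, A b ≠ 0 → DeepBlk k K₀ Ω b.src ∧ DeepBlk k K₀ Ω b.tgt)
    (i₀ : Ix N) {b₀ : HiggsLattice.PBond P 0} (hb₀ : Interior k K₀ Ω b₀.src) (x' : HiggsLattice.Site P 0)
    (j₁ j₂ : ℕ) (u : ScalarField P 0 N) {aw cu : ℝ} (hcu : 0 ≤ cu)
    (huv : ∀ y : HiggsLattice.Site P 0, Interior k K₀ Ω y → ‖u y‖ ≤ cu * P.mesh j₁ ^ (aw - (P.d : ℝ)) *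
      Real.exp (-(δ₁ * (P.mesh j₁)⁻¹ * (P.mesh 0 * (HiggsLattice.Site.tdist y x' : ℝ))))) :
    ‖covDeriv C B (pieceR C Ω B msq a k j₂ ((P.mesh 0)⁻¹ • ∑ b : HiggsLattice.PBond P 0, srcDM C A B b u)) b₀‖
      ≤ (P.d : ℝ) * ((P.mesh 0 ^ P.d * CM) * (Real.exp 1 * (|C.e| * s * cu)) *
            ((nCol N : ℝ) * (8 * P.d / δ₁) ^ P.d * (P.mesh 0 ^ P.d)⁻¹)) *
          (P.mesh j₂ ^ (0 : ℝ) * P.mesh j₁ ^ aw * (P.mesh (max j₂ j₁) ^ P.d)⁻¹) *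
          Real.exp (-(δ₁ / 2 * (P.mesh (max j₂ j₁))⁻¹ * (P.mesh 0 * (HiggsLattice.Site.tdist b₀.src x' : ℝ)))) := by
  have hε := P.mesh_pos 0
  have hes : 0 ≤ |C.e| * s := mul_nonneg (abs_nonneg _) hs
  have hcM : 0 ≤ P.mesh 0 ^ P.d * CM := mul_nonneg (pow_nonneg hε.le _) hCM
  set F : HiggsLattice.PBond P 0 → ℝ := fun b =>
    if DeepBlk k K₀ Ω b.src then (P.mesh 0)⁻¹ * ∑ i : Ix N, ‖covDeriv C B (pieceR C Ω B msq a k j₂ (dip C B b (onb N i))) b₀‖ else 0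
    with hF
  set G : HiggsLattice.PBond P 0 → ℝ := fun b => if DeepBlk k K₀ Ω b.src then |C.e| * s * ‖u b.tgt‖ else 0 with hG
  have hF0 : ∀ b, 0 ≤ F b := fun b => by
    simp only [hF]; split_ifs
    · exact mul_nonneg (inv_nonneg.mpr hε.le) (Finset.sum_nonneg fun _ _ => norm_nonneg _)
    · exact le_rfl
  have hG0 : ∀ b, 0 ≤ G b := fun b => by
    simp only [hG]; split_ifs
    · exact mul_nonneg hes (norm_nonneg _)
    · exact le_rfl
  have step1 : ‖covDeriv C B (pieceR C Ω B msq a k j₂ ((P.mesh 0)⁻¹ • ∑ b : HiggsLattice.PBond P 0, srcDM C A B b u)) b₀‖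
      ≤ ∑ b : HiggsLattice.PBond P 0, F b * G b := by
    rw [map_smul, B3Ineq210RegularTorus.covDeriv_smul'', map_sum, B3Ineq210RegularTorus.covDeriv_sum'', norm_smul, Real.norm_eq_abs,
      abs_of_pos (inv_pos.mpr hε)]
    refine (mul_le_mul_of_nonneg_left (norm_sum_le _ _) (inv_nonneg.mpr hε.le)).trans ?_
    rw [Finset.mul_sum]
    refine Finset.sum_le_sum fun b _ => ?_
    by_cases hb : DeepBlk k K₀ Ω b.src
    · simp only [hF, hG, if_pos hb]
      have h := norm_mapE_srcDM_le C A B (covDerivAt C B b₀ ∘ₗ pieceR C Ω B msq a k j₂) (hA b) u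
      simp only [phiR_apply] at h
      refine (mul_le_mul_of_nonneg_left h (inv_nonneg.mpr hε.le)).trans (le_of_eq ?_)
      ring
    · simp only [hF, hG, if_neg hb, mul_zero]
      rw [srcDM_eq_zero C A B (apply_eq_zero_of_not_deep_src A hAS hb), map_zero, B3Ineq210RegularTorus.covDeriv_zero'', norm_zero,
        mul_zero]
  refine step1.trans ?_
  refine pair_bond_le hδ₁ hδ₁1 j₂ j₁ hcM (mul_nonneg (Real.exp_nonneg _) (mul_nonneg hes hcu)) i₀ b₀.src x' F G hF0 hG0
    (fun b => ?_) (fun b => ?_)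
  · by_cases hb : DeepBlk k K₀ Ω b.src
    · simp only [hF, if_pos hb]; exact pmixR_le hmixB j₂ hb₀ hb.interior
    · simp only [hF, if_neg hb]; exact bump_nonneg hcM _ _ _
  · by_cases hb : DeepBlk k K₀ Ω b.src
    · simp only [hG, if_pos hb]
      have hsh := bump_shift_le' hδ₁.le hδ₁1 j₁ b.src x' b.dir
      have hm : 0 ≤ |C.e| * s * (cu * P.mesh j₁ ^ (aw - (P.d : ℝ))) :=
        mul_nonneg hes (mul_nonneg hcu (Real.rpow_nonneg (P.mesh_pos _).le _))
      calc |C.e| * s * ‖u b.tgt‖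
          ≤ |C.e| * s * (cu * P.mesh j₁ ^ (aw - (P.d : ℝ)) *
              Real.exp (-(δ₁ * (P.mesh j₁)⁻¹ * (P.mesh 0 * (HiggsLattice.Site.tdist (b.src.shift b.dir) x' : ℝ))))) :=
            mul_le_mul_of_nonneg_left (huv b.tgt (hb.interior_shift b.dir)) hes
        _ ≤ |C.e| * s * (cu * P.mesh j₁ ^ (aw - (P.d : ℝ))) *
              (Real.exp 1 * Real.exp (-(δ₁ * (P.mesh j₁)⁻¹ * (P.mesh 0 * (HiggsLattice.Site.tdist b.src x' : ℝ))))) := by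
            rw [← mul_assoc]; exact mul_le_mul_of_nonneg_left hsh hm
        _ = _ := by ring
    · simp only [hG, if_neg hb]; exact bump_nonneg (mul_nonneg (Real.exp_nonneg _) (mul_nonneg hes hcu)) _ _ _

/-- **PAIR BOUND 4 ON A REGION — the `D^*M` source in Leibniz form** (THEOREM A′; the Leibniz charge of a bond that is not deep vanishes):
the torus right side of `B3Op116MixedSeed.dm_parts_le`. [cite: Balaban1983Higgs3, (1.16) p.414, (2.6) p.424, (2.10) p.426, p.412] [cite: Balaban1982Higgs1, (2.23) p.610, (3.16) p.615] -/
theorem dm_parts_le_region (hδ₁ : 0 < δ₁) (hδ₁1 : δ₁ ≤ 1) (hCst : 0 ≤ Cst) (hs : 0 ≤ s) (hδA : 0 ≤ δA)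
    (h210B : (regRegionKernels hL1 C Ω B msq a k K₀).Ineq210 δ₁ Cst)
    (hA : ∀ b : HiggsLattice.PBond P 0, |A b| ≤ s)
    (hreg : ∀ (z : HiggsLattice.Site P 0) (μ ν : Fin P.d), |A ⟨z.shift ν, μ⟩ - A ⟨z, μ⟩| ≤ δA)
    (hAS : ∀ b : HiggsLattice.PBond P 0, A b ≠ 0 → DeepBlk k K₀ Ω b.src ∧ DeepBlk k K₀ Ω b.tgt)
    (i₀ : Ix N) {b₀ : HiggsLattice.PBond P 0} (hb₀ : Interior k K₀ Ω b₀.src) (x' : HiggsLattice.Site P 0) (j₁ j₂ : ℕ)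
    (u : ScalarField P 0 N) {aw cu cu' : ℝ} (hcu : 0 ≤ cu) (hcu' : 0 ≤ cu')
    (huv : ∀ y : HiggsLattice.Site P 0, Interior k K₀ Ω y → ‖u y‖ ≤ cu * P.mesh j₁ ^ (aw - (P.d : ℝ)) *
      Real.exp (-(δ₁ * (P.mesh j₁)⁻¹ * (P.mesh 0 * (HiggsLattice.Site.tdist y x' : ℝ)))))
    (hud : ∀ b : HiggsLattice.PBond P 0, Interior k K₀ Ω b.src → ‖covDeriv C B u b‖ ≤ cu' * P.mesh j₁ ^ (aw - 1 - (P.d : ℝ)) *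
      Real.exp (-(δ₁ * (P.mesh j₁)⁻¹ * (P.mesh 0 * (HiggsLattice.Site.tdist b.src x' : ℝ))))) :
    ‖covDeriv C B (pieceR C Ω B msq a k j₂ ((P.mesh 0)⁻¹ • ∑ b : HiggsLattice.PBond P 0, srcDM C A B b u)) b₀‖
      ≤ (P.d : ℝ) * ((P.mesh 0 ^ P.d * Cst) * ((P.mesh 0)⁻¹ * (|C.e| * δA) * cu) *
            ((nCol N : ℝ) * (8 * P.d / δ₁) ^ P.d * (P.mesh 0 ^ P.d)⁻¹)) *
          (P.mesh j₂ ^ (1 : ℝ) * P.mesh j₁ ^ aw * (P.mesh (max j₂ j₁) ^ P.d)⁻¹) *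
          Real.exp (-(δ₁ / 2 * (P.mesh (max j₂ j₁))⁻¹ * (P.mesh 0 * (HiggsLattice.Site.tdist b₀.src x' : ℝ))))
        + (P.d : ℝ) * ((P.mesh 0 ^ P.d * Cst) * (|C.e| * s * cu') *
            ((nCol N : ℝ) * (8 * P.d / δ₁) ^ P.d * (P.mesh 0 ^ P.d)⁻¹)) *
          (P.mesh j₂ ^ (1 : ℝ) * P.mesh j₁ ^ (aw - 1) * (P.mesh (max j₂ j₁) ^ P.d)⁻¹) *
          Real.exp (-(δ₁ / 2 * (P.mesh (max j₂ j₁))⁻¹ * (P.mesh 0 * (HiggsLattice.Site.tdist b₀.src x' : ℝ)))) := by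
  have hε := P.mesh_pos 0
  have hes : 0 ≤ |C.e| * s := mul_nonneg (abs_nonneg _) hs
  have hN : 0 ≤ (P.mesh 0)⁻¹ * (|C.e| * δA) := mul_nonneg (inv_nonneg.mpr hε.le) (mul_nonneg (abs_nonneg _) hδA)
  have hc : 0 ≤ P.mesh 0 ^ P.d * Cst := mul_nonneg (pow_nonneg hε.le _) hCst
  set F : HiggsLattice.PBond P 0 → ℝ := fun b =>
    if DeepBlk k K₀ Ω b.src then ∑ i : Ix N, ‖covDeriv C B (pieceR C Ω B msq a k j₂ (cb P N 0 (b.src, i))) b₀‖ else 0 with hF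
  set G₁ : HiggsLattice.PBond P 0 → ℝ := fun b =>
    if DeepBlk k K₀ Ω b.src then (P.mesh 0)⁻¹ * (|C.e| * δA) * ‖u b.src‖ else 0 with hG₁
  set G₂ : HiggsLattice.PBond P 0 → ℝ := fun b => if DeepBlk k K₀ Ω b.src then |C.e| * s * ‖covDeriv C B u b‖ else 0 with hG₂
  have hF0 : ∀ b, 0 ≤ F b := fun b => by
    simp only [hF]; split_ifs
    · exact Finset.sum_nonneg fun _ _ => norm_nonneg _
    · exact le_rfl
  have hG₁0 : ∀ b, 0 ≤ G₁ b := fun b => by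
    simp only [hG₁]; split_ifs
    · exact mul_nonneg hN (norm_nonneg _)
    · exact le_rfl
  have hG₂0 : ∀ b, 0 ≤ G₂ b := fun b => by
    simp only [hG₂]; split_ifs
    · exact mul_nonneg hes (norm_nonneg _)
    · exact le_rfl
  -- THEOREM A′ and the two resulting bond sums
  have step1 : ‖covDeriv C B (pieceR C Ω B msq a k j₂ ((P.mesh 0)⁻¹ • ∑ b : HiggsLattice.PBond P 0, srcDM C A B b u)) b₀‖
      ≤ (∑ b : HiggsLattice.PBond P 0, F b * G₁ b) + ∑ b : HiggsLattice.PBond P 0, F b * G₂ b := by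
    rw [inv_smul_sum_srcDM_eq, map_sum, B3Ineq210RegularTorus.covDeriv_sum'', ← Finset.sum_add_distrib]
    refine (norm_sum_le _ _).trans (Finset.sum_le_sum fun b _ => ?_)
    by_cases hb : DeepBlk k K₀ Ω b.src
    · simp only [hF, hG₁, hG₂, if_pos hb]
      have h := norm_mapE_single_le (covDerivAt C B b₀ ∘ₗ pieceR C Ω B msq a k j₂) b.src
        (nMul C A b (u b.src) - fOne C (P.mesh 0) (A b) (covDeriv C B u b))
      simp only [phiR_apply] at h
      refine h.trans ?_
      rw [← mul_add, mul_comm]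
      refine mul_le_mul_of_nonneg_left ((norm_sub_le _ _).trans (add_le_add ?_ ?_)) (Finset.sum_nonneg fun _ _ => norm_nonneg _)
      · exact norm_nMul_apply_le C A hreg b _
      · exact norm_fOne_apply_le_of_abs_le (hA b) _
    · simp only [hF, hG₁, hG₂, if_neg hb, mul_zero, add_zero]
      rw [leibnizCharge_eq_zero C A B hAS hb u, Pi.single_zero, map_zero, B3Ineq210RegularTorus.covDeriv_zero'', norm_zero]
  refine step1.trans (add_le_add ?_ ?_)
  · refine pair_bond_le hδ₁ hδ₁1 j₂ j₁ hc (mul_nonneg hN hcu) i₀ b₀.src x' F G₁ hF0 hG₁0 (fun b => ?_) (fun b => ?_)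
    · by_cases hb : DeepBlk k K₀ Ω b.src
      · simp only [hF, if_pos hb]; exact pdcolR_le h210B j₂ hb₀ hb.interior
      · simp only [hF, if_neg hb]; exact bump_nonneg hc _ _ _
    · by_cases hb : DeepBlk k K₀ Ω b.src
      · simp only [hG₁, if_pos hb]
        exact (mul_le_mul_of_nonneg_left (huv b.src hb.interior) hN).trans (le_of_eq (by ring))
      · simp only [hG₁, if_neg hb]; exact bump_nonneg (mul_nonneg hN hcu) _ _ _
  · refine pair_bond_le hδ₁ hδ₁1 j₂ j₁ hc (mul_nonneg hes hcu') i₀ b₀.src x' F G₂ hF0 hG₂0 (fun b => ?_) (fun b => ?_)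
    · by_cases hb : DeepBlk k K₀ Ω b.src
      · simp only [hF, if_pos hb]; exact pdcolR_le h210B j₂ hb₀ hb.interior
      · simp only [hF, if_neg hb]; exact bump_nonneg hc _ _ _
    · by_cases hb : DeepBlk k K₀ Ω b.src
      · simp only [hG₂, if_pos hb]
        exact (mul_le_mul_of_nonneg_left (hud b hb.interior) hes).trans (le_of_eq (by ring))
      · simp only [hG₂, if_neg hb]; exact bump_nonneg (mul_nonneg hes hcu') _ _ _

end Pairs

/-! ## §3 THE SCALE-PAIR SUMS on a region: each pair filed under its coarser index, the finer index summed geometrically -/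

section PairSums

open scoped Classical

variable {C : ChargeData N} {A B : HiggsLattice.VecField P 0} {msq a : ℝ} {k K₀ : ℕ} {hL1 : 1 < P.L} {δ₁ Cst CM s δA : ℝ}
  {Ω : Finset (HiggsLattice.Site P 0)}

/-- **THE `M^*D` SOURCES OF A MULTI-SCALE FIELD THROUGH `D^ε_BG_k(Ω,B)` at a row bond from an interior point, summed over all scale pairs**
(the field pieces bounded at interior sites / bonds from interior sites only): the torus right side of `B3Op116MixedSeed.md_sum_le`.
[cite: Balaban1983Higgs3, (1.16) p.414, (2.6) p.424, (2.10) p.426, p.412] [cite: Balaban1982Higgs1, (3.16) p.615] -/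
theorem md_sum_le_region (hmsq : 0 < msq) (ha : 0 < a) (hk : 1 ≤ k) (hkK : k ≤ P.K) (hδ₁ : 0 < δ₁) (hδ₁1 : δ₁ ≤ 1) (hCst : 0 ≤ Cst)
    (hCM : 0 ≤ CM) (hs : 0 ≤ s) (hδA : 0 ≤ δA)
    (h210B : (regRegionKernels hL1 C Ω B msq a k K₀).Ineq210 δ₁ Cst)
    (hmixB : ∀ (j : ℕ) (μ ν : Fin P.d) (x x' : HiggsLattice.Site P 0), Interior k K₀ Ω x → Interior k K₀ Ω x' →
      mixedTermR C Ω B msq a k j μ ν x x' ≤ CM * (P.mesh j ^ P.d)⁻¹ * Real.exp (-(δ₁ * ((HiggsLattice.Site.tdist x x' : ℝ) / (P.L : ℝ) ^ j))))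
    (hA : ∀ b : HiggsLattice.PBond P 0, |A b| ≤ s)
    (hreg : ∀ (z : HiggsLattice.Site P 0) (μ ν : Fin P.d), |A ⟨z.shift ν, μ⟩ - A ⟨z, μ⟩| ≤ δA)
    (hAS : ∀ b : HiggsLattice.PBond P 0, A b ≠ 0 → DeepBlk k K₀ Ω b.src ∧ DeepBlk k K₀ Ω b.tgt)
    (i₀ : Ix N) {b₀ : HiggsLattice.PBond P 0} (hb₀ : Interior k K₀ Ω b₀.src) (x' : HiggsLattice.Site P 0)
    (w : ScalarField P 0 N) (wp : ℕ → ScalarField P 0 N) (hw : ∑ j ∈ Finset.range k, wp j = w) {aw cw cw' : ℝ} (haw : 0 < aw)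
    (hcw : 0 ≤ cw) (hcw' : 0 ≤ cw')
    (hwv : ∀ (j : ℕ) (y : HiggsLattice.Site P 0), Interior k K₀ Ω y → ‖wp j y‖ ≤ cw * P.mesh j ^ (aw - (P.d : ℝ)) *
      Real.exp (-(δ₁ * (P.mesh j)⁻¹ * (P.mesh 0 * (HiggsLattice.Site.tdist y x' : ℝ)))))
    (hwd : ∀ (j : ℕ) (b : HiggsLattice.PBond P 0), Interior k K₀ Ω b.src → ‖covDeriv C B (wp j) b‖ ≤ cw' * P.mesh j ^ (aw - 1 - (P.d : ℝ)) *
      Real.exp (-(δ₁ * (P.mesh j)⁻¹ * (P.mesh 0 * (HiggsLattice.Site.tdist b.src x' : ℝ))))) :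
    ‖covDeriv C B (propagatorK C Ω B msq a k (∑ b : HiggsLattice.PBond P 0, srcMD C A B b w)) b₀‖
      ≤ ((P.L : ℝ) ^ (1 : ℝ) / ((P.L : ℝ) ^ (1 : ℝ) - 1) *
            ((P.d : ℝ) * ((Real.exp 1 * (P.mesh 0 ^ P.d * Cst)) * (|C.e| * s * cw') *
              ((nCol N : ℝ) * (8 * P.d / δ₁) ^ P.d * (P.mesh 0 ^ P.d)⁻¹)))
          + (P.L : ℝ) ^ aw / ((P.L : ℝ) ^ aw - 1) *
            ((P.d : ℝ) * ((P.mesh 0 ^ P.d * CM) * (|C.e| * s * cw) *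
              ((nCol N : ℝ) * (8 * P.d / δ₁) ^ P.d * (P.mesh 0 ^ P.d)⁻¹)))) *
          ∑ j ∈ Finset.range k, P.mesh j ^ (aw - (P.d : ℝ)) *
            Real.exp (-(δ₁ / 2 * (P.mesh j)⁻¹ * (P.mesh 0 * (HiggsLattice.Site.tdist b₀.src x' : ℝ))))
        + (P.L : ℝ) ^ aw / ((P.L : ℝ) ^ aw - 1) *
            ((P.d : ℝ) * ((P.mesh 0 ^ P.d * Cst) * ((P.mesh 0)⁻¹ * (|C.e| * δA) * cw) *
              ((nCol N : ℝ) * (8 * P.d / δ₁) ^ P.d * (P.mesh 0 ^ P.d)⁻¹))) *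
          ∑ j ∈ Finset.range k, P.mesh j ^ (aw + 1 - (P.d : ℝ)) *
            Real.exp (-(δ₁ / 2 * (P.mesh j)⁻¹ * (P.mesh 0 * (HiggsLattice.Site.tdist b₀.src x' : ℝ)))) := by
  have hL1' : (1 : ℝ) < (P.L : ℝ) := by exact_mod_cast hL1
  have hε := P.mesh_pos 0
  -- names for the constants and the bumps
  set K' : ℝ := (nCol N : ℝ) * (8 * P.d / δ₁) ^ P.d * (P.mesh 0 ^ P.d)⁻¹ with hK'
  set KA : ℝ := (P.d : ℝ) * ((Real.exp 1 * (P.mesh 0 ^ P.d * Cst)) * (|C.e| * s * cw') * K') with hKA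
  set KB1 : ℝ := (P.d : ℝ) * ((P.mesh 0 ^ P.d * Cst) * ((P.mesh 0)⁻¹ * (|C.e| * δA) * cw) * K') with hKB1
  set KB2 : ℝ := (P.d : ℝ) * ((P.mesh 0 ^ P.d * CM) * (|C.e| * s * cw) * K') with hKB2
  have hKA0 : 0 ≤ KA := by rw [hKA, hK']; positivity
  have hKB10 : 0 ≤ KB1 := by rw [hKB1, hK']; positivity
  have hKB20 : 0 ≤ KB2 := by rw [hKB2, hK']; positivity
  set E2 : ℕ → ℝ := fun j => Real.exp (-(δ₁ / 2 * (P.mesh j)⁻¹ * (P.mesh 0 * (HiggsLattice.Site.tdist b₀.src x' : ℝ)))) with hE2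
  have hE20 : ∀ j, 0 ≤ E2 j := fun j => Real.exp_nonneg _
  set G1 : ℝ := (P.L : ℝ) ^ (1 : ℝ) / ((P.L : ℝ) ^ (1 : ℝ) - 1) with hG1
  set Ga : ℝ := (P.L : ℝ) ^ aw / ((P.L : ℝ) ^ aw - 1) with hGa
  have hGa0 : 0 ≤ Ga := by
    have := Real.one_lt_rpow hL1' haw; rw [hGa]; exact div_nonneg (by linarith) (by linarith)
  have hm : ∀ j (e : ℝ), 0 ≤ P.mesh j ^ e := fun j e => Real.rpow_nonneg (P.mesh_pos j).le e
  have hmi : ∀ j, 0 ≤ (P.mesh j ^ P.d)⁻¹ := fun j => inv_nonneg.mpr (pow_nonneg (P.mesh_pos j).le _)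
  -- the double sum over the pieces
  set T : ℕ → ℕ → ℝ := fun j₁ j₂ =>
    ‖covDeriv C B (pieceR C Ω B msq a k j₂ (∑ b : HiggsLattice.PBond P 0, srcMD C A B b (wp j₁))) b₀‖ with hT
  have step1 : ‖covDeriv C B (propagatorK C Ω B msq a k (∑ b : HiggsLattice.PBond P 0, srcMD C A B b w)) b₀‖
      ≤ ∑ j₁ ∈ Finset.range k, ∑ j₂ ∈ Finset.range k, T j₁ j₂ := by
    have hsrc : ∑ b : HiggsLattice.PBond P 0, srcMD C A B b w
        = ∑ j₁ ∈ Finset.range k, ∑ b : HiggsLattice.PBond P 0, srcMD C A B b (wp j₁) := by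
      rw [← hw, Finset.sum_comm]
      exact Finset.sum_congr rfl fun b _ => srcMD_sum C A B _ _ b
    rw [hsrc, map_sum, B3Ineq210RegularTorus.covDeriv_sum'']
    refine (norm_sum_le _ _).trans (Finset.sum_le_sum fun j₁ _ => ?_)
    rw [covDeriv_propagatorK_eq_sum_piecesR C msq a k B B hmsq ha hL1 hk hkK]
    rw [hT]
    exact norm_sum_le (Finset.range k)
      (fun j₂ => covDeriv C B (pieceR C Ω B msq a k j₂ (∑ b : HiggsLattice.PBond P 0, srcMD C A B b (wp j₁))) b₀)
  -- the two cases
  set gA : ℕ → ℝ := fun j₁ => KA * (P.mesh j₁ ^ (aw - 1) * (P.mesh j₁ ^ P.d)⁻¹) * E2 j₁ with hgA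
  set gB : ℕ → ℝ := fun j₂ => (KB1 * (P.mesh j₂ ^ (1 : ℝ) * (P.mesh j₂ ^ P.d)⁻¹) + KB2 * (P.mesh j₂ ^ (0 : ℝ) * (P.mesh j₂ ^ P.d)⁻¹))
    * E2 j₂ with hgB
  have hgA0 : ∀ j, 0 ≤ gA j := fun j => by
    rw [hgA]; exact mul_nonneg (mul_nonneg hKA0 (mul_nonneg (hm j _) (hmi j))) (hE20 j)
  have hgB0 : ∀ j, 0 ≤ gB j := fun j => by
    rw [hgB]
    exact mul_nonneg (add_nonneg (mul_nonneg hKB10 (mul_nonneg (hm j _) (hmi j))) (mul_nonneg hKB20 (mul_nonneg (hm j _) (hmi j))))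
      (hE20 j)
  have hle : ∀ j₁ j₂, j₂ ≤ j₁ → T j₁ j₂ ≤ P.mesh j₂ ^ (1 : ℝ) * gA j₁ := by
    intro j₁ j₂ hj
    have h := md_direct_le_region hδ₁ hδ₁1 hCst hs h210B hA hAS i₀ hb₀ x' j₁ j₂ (wp j₁) hcw' (hwd j₁)
    rw [max_eq_right hj] at h
    refine h.trans (le_of_eq ?_)
    rw [hgA, hKA, hE2]; ring
  have hlt : ∀ j₁ j₂, j₁ < j₂ → T j₁ j₂ ≤ P.mesh j₁ ^ aw * gB j₂ := by
    intro j₁ j₂ hj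
    have h := md_parts_le_region hδ₁ hδ₁1 hCst hCM hs hδA h210B hmixB hA hreg hAS i₀ hb₀ x' j₁ j₂ (wp j₁) hcw (hwv j₁)
    rw [max_eq_left hj.le] at h
    refine h.trans (le_of_eq ?_)
    rw [hgB, hKB1, hKB2, hE2]; ring
  have step2 := sum_sq_le_of_cases k T (fun j₁ j₂ => P.mesh j₂ ^ (1 : ℝ) * gA j₁) (fun j₁ j₂ => P.mesh j₁ ^ aw * gB j₂)
    (fun i j => mul_nonneg (hm i _) (hgB0 j)) hle hlt
  -- the lower triangle: pairs `j₂ ≤ j₁` (PAIR BOUND 1), finer index `j₂` with exponent `1`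
  have step3 : ∑ j₁ ∈ Finset.range k, ∑ j₂ ∈ Finset.range (j₁ + 1), P.mesh j₂ ^ (1 : ℝ) * gA j₁
      ≤ G1 * (KA * ∑ j ∈ Finset.range k, P.mesh j ^ (aw - (P.d : ℝ)) * E2 j) := by
    have hpt : ∀ j, P.mesh j ^ (1 : ℝ) * gA j = KA * (P.mesh j ^ (aw - (P.d : ℝ)) * E2 j) := by
      intro j
      rw [hgA]
      calc P.mesh j ^ (1 : ℝ) * (KA * (P.mesh j ^ (aw - 1) * (P.mesh j ^ P.d)⁻¹) * E2 j)
          = KA * (P.mesh j ^ (1 : ℝ) * P.mesh j ^ (aw - 1) * (P.mesh j ^ P.d)⁻¹) * E2 j := by ring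
        _ = KA * P.mesh j ^ (aw - (P.d : ℝ)) * E2 j := by
            rw [mesh_one_mul_rpow_mul_inv, show (1 : ℝ) + (aw - 1) - (P.d : ℝ) = aw - (P.d : ℝ) by ring]
        _ = _ := by ring
    have hsum : ∑ j ∈ Finset.range k, P.mesh j ^ (1 : ℝ) * gA j = KA * ∑ j ∈ Finset.range k, P.mesh j ^ (aw - (P.d : ℝ)) * E2 j := by
      rw [Finset.mul_sum]; exact Finset.sum_congr rfl fun j _ => hpt j
    refine (sum_lower_pair_le hL1 one_pos k gA hgA0).trans (le_of_eq ?_)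
    rw [hsum]
  -- the upper triangle: pairs `j₁ ≤ j₂` (PAIR BOUND 2), finer index `j₁` with exponent `a_w`
  have step4 : ∑ j₂ ∈ Finset.range k, ∑ j₁ ∈ Finset.range (j₂ + 1), P.mesh j₁ ^ aw * gB j₂
      ≤ Ga * (KB1 * ∑ j ∈ Finset.range k, P.mesh j ^ (aw + 1 - (P.d : ℝ)) * E2 j
          + KB2 * ∑ j ∈ Finset.range k, P.mesh j ^ (aw - (P.d : ℝ)) * E2 j) := by
    have hpt : ∀ j, P.mesh j ^ aw * gB j
        = KB1 * (P.mesh j ^ (aw + 1 - (P.d : ℝ)) * E2 j) + KB2 * (P.mesh j ^ (aw - (P.d : ℝ)) * E2 j) := by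
      intro j
      rw [hgB]
      calc P.mesh j ^ aw * ((KB1 * (P.mesh j ^ (1 : ℝ) * (P.mesh j ^ P.d)⁻¹) + KB2 * (P.mesh j ^ (0 : ℝ) * (P.mesh j ^ P.d)⁻¹)) * E2 j)
          = KB1 * (P.mesh j ^ aw * P.mesh j ^ (1 : ℝ) * (P.mesh j ^ P.d)⁻¹) * E2 j
            + KB2 * (P.mesh j ^ aw * P.mesh j ^ (0 : ℝ) * (P.mesh j ^ P.d)⁻¹) * E2 j := by ring
        _ = KB1 * P.mesh j ^ (aw + 1 - (P.d : ℝ)) * E2 j + KB2 * P.mesh j ^ (aw - (P.d : ℝ)) * E2 j := by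
            rw [mesh_rpow_mul_one_mul_inv, mesh_rpow_mul_zero_mul_inv]
        _ = _ := by ring
    have hsum : ∑ j ∈ Finset.range k, P.mesh j ^ aw * gB j
        = KB1 * ∑ j ∈ Finset.range k, P.mesh j ^ (aw + 1 - (P.d : ℝ)) * E2 j
          + KB2 * ∑ j ∈ Finset.range k, P.mesh j ^ (aw - (P.d : ℝ)) * E2 j := by
      rw [Finset.mul_sum, Finset.mul_sum, ← Finset.sum_add_distrib]; exact Finset.sum_congr rfl fun j _ => hpt j
    refine (sum_lower_pair_le hL1 haw k gB hgB0).trans (le_of_eq ?_)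
    rw [hsum]
  -- assemble
  calc ‖covDeriv C B (propagatorK C Ω B msq a k (∑ b : HiggsLattice.PBond P 0, srcMD C A B b w)) b₀‖
      ≤ ∑ j₁ ∈ Finset.range k, ∑ j₂ ∈ Finset.range k, T j₁ j₂ := step1
    _ ≤ _ := step2
    _ ≤ G1 * (KA * ∑ j ∈ Finset.range k, P.mesh j ^ (aw - (P.d : ℝ)) * E2 j)
        + Ga * (KB1 * ∑ j ∈ Finset.range k, P.mesh j ^ (aw + 1 - (P.d : ℝ)) * E2 j
          + KB2 * ∑ j ∈ Finset.range k, P.mesh j ^ (aw - (P.d : ℝ)) * E2 j) := add_le_add step3 step4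
    _ = _ := by rw [hG1, hGa, hKA, hKB1, hKB2, hK', hE2]; ring

/-- **THE `D^*M` SOURCES OF A MULTI-SCALE FIELD THROUGH `D^ε_BG_k(Ω,B)` at a row bond from an interior point, summed over all scale pairs**:
the torus right side of `B3Op116MixedSeed.dm_sum_le`. [cite: Balaban1983Higgs3, (1.16) p.414, (2.6) p.424, (2.10) p.426, p.412] [cite: Balaban1982Higgs1, (3.16) p.615] -/
theorem dm_sum_le_region (hmsq : 0 < msq) (ha : 0 < a) (hk : 1 ≤ k) (hkK : k ≤ P.K) (hδ₁ : 0 < δ₁) (hδ₁1 : δ₁ ≤ 1) (hCst : 0 ≤ Cst)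
    (hCM : 0 ≤ CM) (hs : 0 ≤ s) (hδA : 0 ≤ δA)
    (h210B : (regRegionKernels hL1 C Ω B msq a k K₀).Ineq210 δ₁ Cst)
    (hmixB : ∀ (j : ℕ) (μ ν : Fin P.d) (x x' : HiggsLattice.Site P 0), Interior k K₀ Ω x → Interior k K₀ Ω x' →
      mixedTermR C Ω B msq a k j μ ν x x' ≤ CM * (P.mesh j ^ P.d)⁻¹ * Real.exp (-(δ₁ * ((HiggsLattice.Site.tdist x x' : ℝ) / (P.L : ℝ) ^ j))))
    (hA : ∀ b : HiggsLattice.PBond P 0, |A b| ≤ s)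
    (hreg : ∀ (z : HiggsLattice.Site P 0) (μ ν : Fin P.d), |A ⟨z.shift ν, μ⟩ - A ⟨z, μ⟩| ≤ δA)
    (hAS : ∀ b : HiggsLattice.PBond P 0, A b ≠ 0 → DeepBlk k K₀ Ω b.src ∧ DeepBlk k K₀ Ω b.tgt)
    (i₀ : Ix N) {b₀ : HiggsLattice.PBond P 0} (hb₀ : Interior k K₀ Ω b₀.src) (x' : HiggsLattice.Site P 0)
    (w : ScalarField P 0 N) (wp : ℕ → ScalarField P 0 N) (hw : ∑ j ∈ Finset.range k, wp j = w) {aw cw cw' : ℝ} (haw : 0 < aw)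
    (hcw : 0 ≤ cw) (hcw' : 0 ≤ cw')
    (hwv : ∀ (j : ℕ) (y : HiggsLattice.Site P 0), Interior k K₀ Ω y → ‖wp j y‖ ≤ cw * P.mesh j ^ (aw - (P.d : ℝ)) *
      Real.exp (-(δ₁ * (P.mesh j)⁻¹ * (P.mesh 0 * (HiggsLattice.Site.tdist y x' : ℝ)))))
    (hwd : ∀ (j : ℕ) (b : HiggsLattice.PBond P 0), Interior k K₀ Ω b.src → ‖covDeriv C B (wp j) b‖ ≤ cw' * P.mesh j ^ (aw - 1 - (P.d : ℝ)) *
      Real.exp (-(δ₁ * (P.mesh j)⁻¹ * (P.mesh 0 * (HiggsLattice.Site.tdist b.src x' : ℝ))))) :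
    ‖covDeriv C B (propagatorK C Ω B msq a k ((P.mesh 0)⁻¹ • ∑ b : HiggsLattice.PBond P 0, srcDM C A B b w)) b₀‖
      ≤ ((P.L : ℝ) ^ aw / ((P.L : ℝ) ^ aw - 1) *
            ((P.d : ℝ) * ((P.mesh 0 ^ P.d * CM) * (Real.exp 1 * (|C.e| * s * cw)) *
              ((nCol N : ℝ) * (8 * P.d / δ₁) ^ P.d * (P.mesh 0 ^ P.d)⁻¹)))
          + (P.L : ℝ) ^ (1 : ℝ) / ((P.L : ℝ) ^ (1 : ℝ) - 1) *
            ((P.d : ℝ) * ((P.mesh 0 ^ P.d * Cst) * (|C.e| * s * cw') *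
              ((nCol N : ℝ) * (8 * P.d / δ₁) ^ P.d * (P.mesh 0 ^ P.d)⁻¹)))) *
          ∑ j ∈ Finset.range k, P.mesh j ^ (aw - (P.d : ℝ)) *
            Real.exp (-(δ₁ / 2 * (P.mesh j)⁻¹ * (P.mesh 0 * (HiggsLattice.Site.tdist b₀.src x' : ℝ))))
        + (P.L : ℝ) ^ (1 : ℝ) / ((P.L : ℝ) ^ (1 : ℝ) - 1) *
            ((P.d : ℝ) * ((P.mesh 0 ^ P.d * Cst) * ((P.mesh 0)⁻¹ * (|C.e| * δA) * cw) *
              ((nCol N : ℝ) * (8 * P.d / δ₁) ^ P.d * (P.mesh 0 ^ P.d)⁻¹))) *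
          ∑ j ∈ Finset.range k, P.mesh j ^ (aw + 1 - (P.d : ℝ)) *
            Real.exp (-(δ₁ / 2 * (P.mesh j)⁻¹ * (P.mesh 0 * (HiggsLattice.Site.tdist b₀.src x' : ℝ)))) := by
  have hL1' : (1 : ℝ) < (P.L : ℝ) := by exact_mod_cast hL1
  have hε := P.mesh_pos 0
  set K' : ℝ := (nCol N : ℝ) * (8 * P.d / δ₁) ^ P.d * (P.mesh 0 ^ P.d)⁻¹ with hK'
  set KD : ℝ := (P.d : ℝ) * ((P.mesh 0 ^ P.d * CM) * (Real.exp 1 * (|C.e| * s * cw)) * K') with hKD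
  set KP1 : ℝ := (P.d : ℝ) * ((P.mesh 0 ^ P.d * Cst) * ((P.mesh 0)⁻¹ * (|C.e| * δA) * cw) * K') with hKP1
  set KP2 : ℝ := (P.d : ℝ) * ((P.mesh 0 ^ P.d * Cst) * (|C.e| * s * cw') * K') with hKP2
  have hKD0 : 0 ≤ KD := by rw [hKD, hK']; positivity
  have hKP10 : 0 ≤ KP1 := by rw [hKP1, hK']; positivity
  have hKP20 : 0 ≤ KP2 := by rw [hKP2, hK']; positivity
  set E2 : ℕ → ℝ := fun j => Real.exp (-(δ₁ / 2 * (P.mesh j)⁻¹ * (P.mesh 0 * (HiggsLattice.Site.tdist b₀.src x' : ℝ)))) with hE2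
  have hE20 : ∀ j, 0 ≤ E2 j := fun j => Real.exp_nonneg _
  set G1 : ℝ := (P.L : ℝ) ^ (1 : ℝ) / ((P.L : ℝ) ^ (1 : ℝ) - 1) with hG1
  set Ga : ℝ := (P.L : ℝ) ^ aw / ((P.L : ℝ) ^ aw - 1) with hGa
  have hm : ∀ j (e : ℝ), 0 ≤ P.mesh j ^ e := fun j e => Real.rpow_nonneg (P.mesh_pos j).le e
  have hmi : ∀ j, 0 ≤ (P.mesh j ^ P.d)⁻¹ := fun j => inv_nonneg.mpr (pow_nonneg (P.mesh_pos j).le _)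
  -- the double sum over the pieces, OUTER index = the piece `j₂` of `G_B`, inner = the piece `j₁` of `w`
  set T : ℕ → ℕ → ℝ := fun j₂ j₁ =>
    ‖covDeriv C B (pieceR C Ω B msq a k j₂ ((P.mesh 0)⁻¹ • ∑ b : HiggsLattice.PBond P 0, srcDM C A B b (wp j₁))) b₀‖ with hT
  have step1 : ‖covDeriv C B (propagatorK C Ω B msq a k ((P.mesh 0)⁻¹ • ∑ b : HiggsLattice.PBond P 0, srcDM C A B b w)) b₀‖
      ≤ ∑ j₂ ∈ Finset.range k, ∑ j₁ ∈ Finset.range k, T j₂ j₁ := by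
    have hsrc : (P.mesh 0)⁻¹ • ∑ b : HiggsLattice.PBond P 0, srcDM C A B b w
        = ∑ j₁ ∈ Finset.range k, (P.mesh 0)⁻¹ • ∑ b : HiggsLattice.PBond P 0, srcDM C A B b (wp j₁) := by
      rw [← hw, ← Finset.smul_sum, Finset.sum_comm]
      congr 1
      exact Finset.sum_congr rfl fun b _ => srcDM_sum C A B _ _ b
    rw [hsrc, map_sum, B3Ineq210RegularTorus.covDeriv_sum'']
    refine (norm_sum_le _ _).trans ?_
    rw [Finset.sum_comm]
    refine Finset.sum_le_sum fun j₁ _ => ?_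
    rw [covDeriv_propagatorK_eq_sum_piecesR C msq a k B B hmsq ha hL1 hk hkK]
    rw [hT]
    exact norm_sum_le (Finset.range k)
      (fun j₂ => covDeriv C B (pieceR C Ω B msq a k j₂
        ((P.mesh 0)⁻¹ • ∑ b : HiggsLattice.PBond P 0, srcDM C A B b (wp j₁))) b₀)
  -- the two cases
  set gD : ℕ → ℝ := fun j₂ => KD * (P.mesh j₂ ^ (0 : ℝ) * (P.mesh j₂ ^ P.d)⁻¹) * E2 j₂ with hgD
  set gP : ℕ → ℝ := fun j₁ => (KP1 * (P.mesh j₁ ^ aw * (P.mesh j₁ ^ P.d)⁻¹) + KP2 * (P.mesh j₁ ^ (aw - 1) * (P.mesh j₁ ^ P.d)⁻¹))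
    * E2 j₁ with hgP
  have hgD0 : ∀ j, 0 ≤ gD j := fun j => by
    rw [hgD]; exact mul_nonneg (mul_nonneg hKD0 (mul_nonneg (hm j _) (hmi j))) (hE20 j)
  have hgP0 : ∀ j, 0 ≤ gP j := fun j => by
    rw [hgP]
    exact mul_nonneg (add_nonneg (mul_nonneg hKP10 (mul_nonneg (hm j _) (hmi j))) (mul_nonneg hKP20 (mul_nonneg (hm j _) (hmi j))))
      (hE20 j)
  have hle : ∀ j₂ j₁, j₁ ≤ j₂ → T j₂ j₁ ≤ P.mesh j₁ ^ aw * gD j₂ := by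
    intro j₂ j₁ hj
    have h := dm_direct_le_region hδ₁ hδ₁1 hCM hs hmixB hA hAS i₀ hb₀ x' j₁ j₂ (wp j₁) hcw (hwv j₁)
    rw [max_eq_left hj] at h
    refine h.trans (le_of_eq ?_)
    rw [hgD, hKD, hE2]; ring
  have hlt : ∀ j₂ j₁, j₂ < j₁ → T j₂ j₁ ≤ P.mesh j₂ ^ (1 : ℝ) * gP j₁ := by
    intro j₂ j₁ hj
    have h := dm_parts_le_region hδ₁ hδ₁1 hCst hs hδA h210B hA hreg hAS i₀ hb₀ x' j₁ j₂ (wp j₁) hcw hcw' (hwv j₁) (hwd j₁)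
    rw [max_eq_right hj.le] at h
    refine h.trans (le_of_eq ?_)
    rw [hgP, hKP1, hKP2, hE2]; ring
  have step2 := sum_sq_le_of_cases k T (fun j₂ j₁ => P.mesh j₁ ^ aw * gD j₂) (fun j₂ j₁ => P.mesh j₂ ^ (1 : ℝ) * gP j₁)
    (fun i j => mul_nonneg (hm i _) (hgP0 j)) hle hlt
  -- pairs `j₁ ≤ j₂` (PAIR BOUND 3): finer index `j₁` with exponent `a_w`
  have step3 : ∑ j₂ ∈ Finset.range k, ∑ j₁ ∈ Finset.range (j₂ + 1), P.mesh j₁ ^ aw * gD j₂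
      ≤ Ga * (KD * ∑ j ∈ Finset.range k, P.mesh j ^ (aw - (P.d : ℝ)) * E2 j) := by
    have hpt : ∀ j, P.mesh j ^ aw * gD j = KD * (P.mesh j ^ (aw - (P.d : ℝ)) * E2 j) := by
      intro j
      rw [hgD]
      calc P.mesh j ^ aw * (KD * (P.mesh j ^ (0 : ℝ) * (P.mesh j ^ P.d)⁻¹) * E2 j)
          = KD * (P.mesh j ^ aw * P.mesh j ^ (0 : ℝ) * (P.mesh j ^ P.d)⁻¹) * E2 j := by ring
        _ = KD * P.mesh j ^ (aw - (P.d : ℝ)) * E2 j := by rw [mesh_rpow_mul_zero_mul_inv]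
        _ = _ := by ring
    have hsum : ∑ j ∈ Finset.range k, P.mesh j ^ aw * gD j = KD * ∑ j ∈ Finset.range k, P.mesh j ^ (aw - (P.d : ℝ)) * E2 j := by
      rw [Finset.mul_sum]; exact Finset.sum_congr rfl fun j _ => hpt j
    refine (sum_lower_pair_le hL1 haw k gD hgD0).trans (le_of_eq ?_)
    rw [hsum]
  -- pairs `j₂ < j₁` (PAIR BOUND 4): finer index `j₂` with exponent `1`
  have step4 : ∑ j₁ ∈ Finset.range k, ∑ j₂ ∈ Finset.range (j₁ + 1), P.mesh j₂ ^ (1 : ℝ) * gP j₁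
      ≤ G1 * (KP1 * ∑ j ∈ Finset.range k, P.mesh j ^ (aw + 1 - (P.d : ℝ)) * E2 j
          + KP2 * ∑ j ∈ Finset.range k, P.mesh j ^ (aw - (P.d : ℝ)) * E2 j) := by
    have hpt : ∀ j, P.mesh j ^ (1 : ℝ) * gP j
        = KP1 * (P.mesh j ^ (aw + 1 - (P.d : ℝ)) * E2 j) + KP2 * (P.mesh j ^ (aw - (P.d : ℝ)) * E2 j) := by
      intro j
      rw [hgP]
      calc P.mesh j ^ (1 : ℝ) * ((KP1 * (P.mesh j ^ aw * (P.mesh j ^ P.d)⁻¹) + KP2 * (P.mesh j ^ (aw - 1) * (P.mesh j ^ P.d)⁻¹)) * E2 j)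
          = KP1 * (P.mesh j ^ (1 : ℝ) * P.mesh j ^ aw * (P.mesh j ^ P.d)⁻¹) * E2 j
            + KP2 * (P.mesh j ^ (1 : ℝ) * P.mesh j ^ (aw - 1) * (P.mesh j ^ P.d)⁻¹) * E2 j := by ring
        _ = KP1 * P.mesh j ^ (aw + 1 - (P.d : ℝ)) * E2 j + KP2 * P.mesh j ^ (aw - (P.d : ℝ)) * E2 j := by
            rw [mesh_one_mul_rpow_mul_inv, mesh_one_mul_rpow_mul_inv, show (1 : ℝ) + aw - (P.d : ℝ) = aw + 1 - (P.d : ℝ) by ring,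
              show (1 : ℝ) + (aw - 1) - (P.d : ℝ) = aw - (P.d : ℝ) by ring]
        _ = _ := by ring
    have hsum : ∑ j ∈ Finset.range k, P.mesh j ^ (1 : ℝ) * gP j
        = KP1 * ∑ j ∈ Finset.range k, P.mesh j ^ (aw + 1 - (P.d : ℝ)) * E2 j
          + KP2 * ∑ j ∈ Finset.range k, P.mesh j ^ (aw - (P.d : ℝ)) * E2 j := by
      rw [Finset.mul_sum, Finset.mul_sum, ← Finset.sum_add_distrib]; exact Finset.sum_congr rfl fun j _ => hpt j
    refine (sum_lower_pair_le hL1 one_pos k gP hgP0).trans (le_of_eq ?_)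
    rw [hsum]
  -- assemble
  calc ‖covDeriv C B (propagatorK C Ω B msq a k ((P.mesh 0)⁻¹ • ∑ b : HiggsLattice.PBond P 0, srcDM C A B b w)) b₀‖
      ≤ ∑ j₂ ∈ Finset.range k, ∑ j₁ ∈ Finset.range k, T j₂ j₁ := step1
    _ ≤ _ := step2
    _ ≤ Ga * (KD * ∑ j ∈ Finset.range k, P.mesh j ^ (aw - (P.d : ℝ)) * E2 j)
        + G1 * (KP1 * ∑ j ∈ Finset.range k, P.mesh j ^ (aw + 1 - (P.d : ℝ)) * E2 j
          + KP2 * ∑ j ∈ Finset.range k, P.mesh j ^ (aw - (P.d : ℝ)) * E2 j) := add_le_add step3 step4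
    _ = _ := by rw [hG1, hGa, hKD, hKP1, hKP2, hK', hE2]; ring

end PairSums

/-! ## §4 The `M^*M` sources and the averaging sources on a region (the totals of `G_k(Ω,B)` at interior pairs) -/

section Totals

open scoped Classical

variable {C : ChargeData N} {A B : HiggsLattice.VecField P 0} {msq a : ℝ} {k K₀ : ℕ} {hL1 : 1 < P.L} {δ₁ Cst s : ℝ}
  {Ω : Finset (HiggsLattice.Site P 0)}

/-- The value of a multi-scale field at an interior site is below its majorant. [cite: Balaban1983Higgs3, (2.6) p.424] -/
theorem norm_le_majorant_of_pieces_region (w : ScalarField P 0 N) (wp : ℕ → ScalarField P 0 N) (hw : ∑ j ∈ Finset.range k, wp j = w)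
    (x' : HiggsLattice.Site P 0) {aw cw : ℝ}
    (hwv : ∀ (j : ℕ) (y : HiggsLattice.Site P 0), Interior k K₀ Ω y → ‖wp j y‖ ≤ cw * P.mesh j ^ (aw - (P.d : ℝ)) *
      Real.exp (-(δ₁ * (P.mesh j)⁻¹ * (P.mesh 0 * (HiggsLattice.Site.tdist y x' : ℝ))))) {y : HiggsLattice.Site P 0}
    (hy : Interior k K₀ Ω y) :
    ‖w y‖ ≤ ∑ j ∈ Finset.range k, cw * P.mesh j ^ (aw - (P.d : ℝ)) *
      Real.exp (-(δ₁ * (P.mesh j)⁻¹ * (P.mesh 0 * (HiggsLattice.Site.tdist y x' : ℝ)))) := by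
  rw [← hw, Finset.sum_apply]
  exact (norm_sum_le _ _).trans (Finset.sum_le_sum fun j _ => hwv j y hy)

/-- **THE `M^*M` SOURCES through `D^ε_BG_k(Ω,B)` on a region** (row bond from an interior point; bonds that are not deep carry no `M^*M`
source): the torus right side of `B3Op116MixedSeed.mm_le`. [cite: Balaban1983Higgs3, (1.16) p.414, (2.6) p.424, (2.10) p.426, p.412] [cite: Balaban1982Higgs1, (3.16) p.615] -/
theorem mm_le_region (hmsq : 0 < msq) (ha : 0 < a) (hk : 1 ≤ k) (hkK : k ≤ P.K) (hδ₁ : 0 < δ₁) (hδ₁1 : δ₁ ≤ 1) (hCst : 0 ≤ Cst)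
    (hs : 0 ≤ s) (h210B : (regRegionKernels hL1 C Ω B msq a k K₀).Ineq210 δ₁ Cst)
    (hA : ∀ b : HiggsLattice.PBond P 0, |A b| ≤ s)
    (hAS : ∀ b : HiggsLattice.PBond P 0, A b ≠ 0 → DeepBlk k K₀ Ω b.src ∧ DeepBlk k K₀ Ω b.tgt)
    (i₀ : Ix N) {b₀ : HiggsLattice.PBond P 0} (hb₀ : Interior k K₀ Ω b₀.src) (x' : HiggsLattice.Site P 0)
    (w : ScalarField P 0 N) (wp : ℕ → ScalarField P 0 N) (hw : ∑ j ∈ Finset.range k, wp j = w) {aw cw : ℝ} (haw : 0 < aw)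
    (hcw : 0 ≤ cw)
    (hwv : ∀ (j : ℕ) (y : HiggsLattice.Site P 0), Interior k K₀ Ω y → ‖wp j y‖ ≤ cw * P.mesh j ^ (aw - (P.d : ℝ)) *
      Real.exp (-(δ₁ * (P.mesh j)⁻¹ * (P.mesh 0 * (HiggsLattice.Site.tdist y x' : ℝ))))) :
    ∑ b : HiggsLattice.PBond P 0, ‖covDeriv C B (propagatorK C Ω B msq a k (srcMM C A B b w)) b₀‖
      ≤ (P.d : ℝ) * ∑ j ∈ Finset.range k, ((Real.exp 1 * (P.mesh 0 ^ P.d * Cst)) * (Real.exp 1 * ((|C.e| * s) ^ 2 * cw)) *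
            ((nCol N : ℝ) * (8 * P.d / δ₁) ^ P.d * (P.mesh 0 ^ P.d)⁻¹ *
              ((P.L : ℝ) ^ (1 : ℝ) / ((P.L : ℝ) ^ (1 : ℝ) - 1) + (P.L : ℝ) ^ aw / ((P.L : ℝ) ^ aw - 1)))) *
          P.mesh j ^ ((1 : ℝ) + aw - (P.d : ℝ)) *
          Real.exp (-(δ₁ / 2 * (P.mesh j)⁻¹ * (P.mesh 0 * (HiggsLattice.Site.tdist b₀.src x' : ℝ)))) := by
  have hes : 0 ≤ (|C.e| * s) ^ 2 := pow_nonneg (mul_nonneg (abs_nonneg _) hs) 2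
  have hc : 0 ≤ P.mesh 0 ^ P.d * Cst := mul_nonneg (pow_nonneg (P.mesh_pos 0).le _) hCst
  set F : HiggsLattice.PBond P 0 → ℝ := fun b =>
    if DeepBlk k K₀ Ω b.src then ∑ i : Ix N, ‖covDeriv C B (propagatorK C Ω B msq a k (cb P N 0 (b.tgt, i))) b₀‖ else 0 with hF
  set G : HiggsLattice.PBond P 0 → ℝ := fun b => if DeepBlk k K₀ Ω b.src then (|C.e| * s) ^ 2 * ‖w b.tgt‖ else 0 with hG
  have hF0 : ∀ b, 0 ≤ F b := fun b => by
    simp only [hF]; split_ifs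
    · exact Finset.sum_nonneg fun _ _ => norm_nonneg _
    · exact le_rfl
  have hG0 : ∀ b, 0 ≤ G b := fun b => by
    simp only [hG]; split_ifs
    · exact mul_nonneg hes (norm_nonneg _)
    · exact le_rfl
  have step1 : ∑ b : HiggsLattice.PBond P 0, ‖covDeriv C B (propagatorK C Ω B msq a k (srcMM C A B b w)) b₀‖
      ≤ ∑ b : HiggsLattice.PBond P 0, F b * G b := by
    refine Finset.sum_le_sum fun b _ => ?_
    by_cases hb : DeepBlk k K₀ Ω b.src
    · simp only [hF, hG, if_pos hb]
      have h := norm_mapE_srcMM_le C A B (covDerivAt C B b₀ ∘ₗ propagatorK C Ω B msq a k) (hA b) w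
      simp only [LinearMap.coe_comp, Function.comp_apply, covDerivAt_apply] at h
      refine h.trans (le_of_eq ?_)
      ring
    · simp only [hF, hG, if_neg hb, mul_zero]
      rw [srcMM_eq_zero C A B (apply_eq_zero_of_not_deep_src A hAS hb), map_zero, B3Ineq210RegularTorus.covDeriv_zero'', norm_zero]
  refine step1.trans ?_
  refine sum_bond_kernel_mul_le hL1 hδ₁ hδ₁1 one_pos haw (mul_nonneg (Real.exp_nonneg _) hc)
    (mul_nonneg (Real.exp_nonneg _) (mul_nonneg hes hcw)) i₀ b₀.src x' F G hF0 hG0 (fun b => ?_) (fun b => ?_)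
  · by_cases hb : DeepBlk k K₀ Ω b.src
    · simp only [hF, if_pos hb]
      exact (dcol_le_of_ineq210 C Ω B h210B hmsq ha hk hkK hb₀ (hb.interior_shift b.dir)).trans
        (majorant_shift_le hδ₁ hδ₁1 hc b₀.src b.src b.dir)
    · simp only [hF, if_neg hb]; exact majorant_nonneg (mul_nonneg (Real.exp_nonneg _) hc) _ _
  · by_cases hb : DeepBlk k K₀ Ω b.src
    · simp only [hG, if_pos hb]
      have h1 := norm_le_majorant_of_pieces_region w wp hw x' hwv (hb.interior_shift b.dir)
      have h2 := majorant_shift_le' (k := k) (a := aw - (P.d : ℝ)) hδ₁ hδ₁1 hcw b.src x' b.dir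
      calc (|C.e| * s) ^ 2 * ‖w b.tgt‖
          ≤ (|C.e| * s) ^ 2 * ∑ j ∈ Finset.range k, (Real.exp 1 * cw) * P.mesh j ^ (aw - (P.d : ℝ)) *
              Real.exp (-(δ₁ * (P.mesh j)⁻¹ * (P.mesh 0 * (HiggsLattice.Site.tdist b.src x' : ℝ)))) :=
            mul_le_mul_of_nonneg_left (h1.trans h2) hes
        _ = _ := by rw [Finset.mul_sum]; exact Finset.sum_congr rfl fun j _ => by ring
    · simp only [hG, if_neg hb]; exact majorant_nonneg (mul_nonneg (Real.exp_nonneg _) (mul_nonneg hes hcw)) _ _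

/-- **THE AVERAGING SOURCES through `D^ε_BG_k(Ω,B)` on a region** (file R1's `norm_mapE_avgSrc_region_le`: block averages of the values at
INTERIOR sites against the differentiated column at INTERIOR sites; the engine's `block_avg_majorant_le` on `cutV w`): the torus right side
of `B3Op116MixedSeed.avg_le`. [cite: Balaban1982Higgs1, (3.15) p.614, (3.16) p.615] [cite: Balaban1983Higgs3, (1.16) p.414, (2.10) p.426, p.412] -/
theorem avg_le_region (hmsq : 0 < msq) (ha : 0 < a) (hk : 1 ≤ k) (hkK : k ≤ P.K) (hδ₁ : 0 < δ₁) (hδ₁1 : δ₁ ≤ 1) (hCst : 0 ≤ Cst)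
    (hs : 0 ≤ s) (h210B : (regRegionKernels hL1 C Ω B msq a k K₀).Ineq210 δ₁ Cst)
    (hA : ∀ b : HiggsLattice.PBond P 0, |A b| ≤ s)
    (hAS : ∀ b : HiggsLattice.PBond P 0, A b ≠ 0 → DeepBlk k K₀ Ω b.src ∧ DeepBlk k K₀ Ω b.tgt)
    (i₀ : Ix N) {b₀ : HiggsLattice.PBond P 0} (hb₀ : Interior k K₀ Ω b₀.src) (x' : HiggsLattice.Site P 0)
    (w : ScalarField P 0 N) (wp : ℕ → ScalarField P 0 N) (hw : ∑ j ∈ Finset.range k, wp j = w) {aw cw : ℝ} (haw : 0 < aw)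
    (hcw : 0 ≤ cw)
    (hwv : ∀ (j : ℕ) (y : HiggsLattice.Site P 0), Interior k K₀ Ω y → ‖wp j y‖ ≤ cw * P.mesh j ^ (aw - (P.d : ℝ)) *
      Real.exp (-(δ₁ * (P.mesh j)⁻¹ * (P.mesh 0 * (HiggsLattice.Site.tdist y x' : ℝ))))) :
    ‖covDeriv C B (propagatorK C Ω B msq a k (avgSrc C A B k w)) b₀‖
      ≤ ((|C.e| * s * P.mesh 0 * (P.d * ((P.L : ℝ) ^ k - 1))) * (2 + |C.e| * s * P.mesh 0 * (P.d * ((P.L : ℝ) ^ k - 1)))) *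
        ∑ j ∈ Finset.range (k + 1), ((P.mesh 0 ^ P.d * Cst) *
            ((Real.exp (δ₁ / 2) * ((nCol N : ℝ) * (4 * P.d / (δ₁ / 2)) ^ P.d) / ((P.L : ℝ) ^ aw - 1)) * cw) *
            ((nCol N : ℝ) * (8 * P.d / (δ₁ / 2)) ^ P.d * (P.mesh 0 ^ P.d)⁻¹ *
              ((P.L : ℝ) ^ (1 : ℝ) / ((P.L : ℝ) ^ (1 : ℝ) - 1) + (P.L : ℝ) ^ aw / ((P.L : ℝ) ^ aw - 1)))) *
          P.mesh j ^ ((1 : ℝ) + aw - (P.d : ℝ)) *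
          Real.exp (-(δ₁ / 2 / 2 * (P.mesh j)⁻¹ * (P.mesh 0 * (HiggsLattice.Site.tdist b₀.src x' : ℝ)))) := by
  have hL1' : (1 : ℝ) < (P.L : ℝ) := by exact_mod_cast hL1
  have hε := P.mesh_pos 0
  have hc : 0 ≤ P.mesh 0 ^ P.d * Cst := mul_nonneg (pow_nonneg hε.le _) hCst
  set m : ℝ := |C.e| * s * P.mesh 0 * (P.d * ((P.L : ℝ) ^ k - 1)) with hm
  have hLk1 : (1 : ℝ) ≤ (P.L : ℝ) ^ k := one_le_pow₀ hL1'.le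
  have hm0 : 0 ≤ m := by
    have : (0 : ℝ) ≤ (P.L : ℝ) ^ k - 1 := by linarith
    rw [hm]; positivity
  set Cb : ℝ := (Real.exp (δ₁ / 2) * ((nCol N : ℝ) * (4 * P.d / (δ₁ / 2)) ^ P.d) / ((P.L : ℝ) ^ aw - 1)) * cw with hCb
  have hCb0 : 0 ≤ Cb := by
    have h1 : 0 < (P.L : ℝ) ^ aw - 1 := by have := Real.one_lt_rpow hL1' haw; linarith
    have h2 : 0 ≤ (4 * (P.d : ℝ) / (δ₁ / 2)) ^ P.d := pow_nonneg (by positivity) _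
    rw [hCb]; positivity
  set T := covDerivAt C B b₀ ∘ₗ propagatorK C Ω B msq a k with hT
  -- the averaging sources through the functional: block averages of the truncated values against the truncated column
  have step1 := norm_mapE_avgSrc_region_le C A B k T hkK hs hA hAS w
  -- each block average of the truncated values is a top bump of exponent `a_w`
  have hmaj0 : ∀ x : HiggsLattice.Site P 0, 0 ≤ ∑ j ∈ Finset.range k, cw * P.mesh j ^ (aw - (P.d : ℝ)) *
      Real.exp (-(δ₁ * (P.mesh j)⁻¹ * (P.mesh 0 * (HiggsLattice.Site.tdist x x' : ℝ)))) := fun x => majorant_nonneg hcw x x'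
  have hblk : ∀ y : HiggsLattice.Site P 0,
      ((P.L : ℝ) ^ (k * P.d))⁻¹ * ∑ x ∈ blockK k (blockIter k y), cutV k K₀ Ω w x
        ≤ Cb * (P.mesh k ^ aw * (P.mesh k ^ P.d)⁻¹) *
          Real.exp (-(δ₁ / 2 * (P.mesh k)⁻¹ * (P.mesh 0 * (HiggsLattice.Site.tdist y x' : ℝ)))) := by
    intro y
    have h := block_avg_majorant_le (N := N) hL1 hk hkK hδ₁ hδ₁1 hcw haw i₀ (cutV k K₀ Ω w) y x'
      (fun x _ => cutV_le_of w hmaj0 (fun z hz => norm_le_majorant_of_pieces_region w wp hw x' hwv hz) x)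
    refine h.trans (le_of_eq ?_)
    rw [hCb]
  -- the truncated column against the bump: two kernels at range `k + 1`, rate `δ₁/2`
  have hδ2 : 0 < δ₁ / 2 := half_pos hδ₁
  have hδ21 : δ₁ / 2 ≤ 1 := by linarith
  have hcol : ∀ y : HiggsLattice.Site P 0, cutK k K₀ Ω T y ≤ ∑ j ∈ Finset.range (k + 1), (P.mesh 0 ^ P.d * Cst) *
      P.mesh j ^ ((1 : ℝ) - (P.d : ℝ)) * Real.exp (-(δ₁ / 2 * (P.mesh j)⁻¹ * (P.mesh 0 * (HiggsLattice.Site.tdist b₀.src y : ℝ)))) := by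
    intro y
    refine cutK_le_of T (fun z => majorant_nonneg hc b₀.src z) (fun z hz => ?_) y
    have h := dcol_le_of_ineq210 C Ω B h210B hmsq ha hk hkK hb₀ hz
    simp only [hT, LinearMap.coe_comp, Function.comp_apply, covDerivAt_apply]
    exact h.trans (majorant_mono hc (by linarith) (Nat.le_succ k) b₀.src z)
  have step2 : ∑ y : HiggsLattice.Site P 0, cutK k K₀ Ω T y *
        (((P.L : ℝ) ^ (k * P.d))⁻¹ * ∑ x ∈ blockK k (blockIter k y), cutV k K₀ Ω w x)
      ≤ ∑ j ∈ Finset.range (k + 1), ((P.mesh 0 ^ P.d * Cst) * Cb *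
            ((nCol N : ℝ) * (8 * P.d / (δ₁ / 2)) ^ P.d * (P.mesh 0 ^ P.d)⁻¹ *
              ((P.L : ℝ) ^ (1 : ℝ) / ((P.L : ℝ) ^ (1 : ℝ) - 1) + (P.L : ℝ) ^ aw / ((P.L : ℝ) ^ aw - 1)))) *
          P.mesh j ^ ((1 : ℝ) + aw - (P.d : ℝ)) *
          Real.exp (-(δ₁ / 2 / 2 * (P.mesh j)⁻¹ * (P.mesh 0 * (HiggsLattice.Site.tdist b₀.src x' : ℝ)))) := by
    refine sum_kernel_mul_le hL1 hδ2 hδ21 one_pos haw hc hCb0 i₀ b₀.src x' _ _ (fun y => cutK_nonneg T y)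
      (fun y => mul_nonneg (inv_nonneg.mpr (pow_nonneg (Nat.cast_nonneg _) _)) (Finset.sum_nonneg fun _ _ => cutV_nonneg w _))
      hcol (fun y => ?_)
    refine (hblk y).trans ?_
    rw [mesh_rpow_mul_inv_pow_eq]
    exact top_bump_le_majorant_succ hCb0 y x'
  calc ‖covDeriv C B (propagatorK C Ω B msq a k (avgSrc C A B k w)) b₀‖
      = ‖T (avgSrc C A B k w)‖ := by simp only [hT, LinearMap.coe_comp, Function.comp_apply, covDerivAt_apply]
    _ ≤ ∑ y : HiggsLattice.Site P 0, (m * (2 + m) * (((P.L : ℝ) ^ (k * P.d))⁻¹ * ∑ x ∈ blockK k (blockIter k y), cutV k K₀ Ω w x)) *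
          cutK k K₀ Ω T y := step1
    _ = m * (2 + m) * ∑ y : HiggsLattice.Site P 0, cutK k K₀ Ω T y *
          (((P.L : ℝ) ^ (k * P.d))⁻¹ * ∑ x ∈ blockK k (blockIter k y), cutV k K₀ Ω w x) := by
        rw [Finset.mul_sum]; exact Finset.sum_congr rfl fun y _ => by ring
    _ ≤ _ := mul_le_mul_of_nonneg_left step2 (mul_nonneg hm0 (by linarith))

end Totals

/-! ## §5 THE ROW THEOREM ON A REGION: `D^ε_BG_k(Ω,B̃)V_k(Ã,B̃)` on a multi-scale field, at a row bond from an interior point -/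

section RowTheorem

open scoped Classical

variable {C : ChargeData N} {A B : HiggsLattice.VecField P 0} {msq a : ℝ} {k K₀ : ℕ} {hL1 : 1 < P.L} {δ₁ Cst CM s δA : ℝ}
  {Ω : Finset (HiggsLattice.Site P 0)}

/-- **THE ROW THEOREM ON A REGION.**  For a region `Ω`, backgrounds `Ã = A` (small `sup_b|A_b| ≤ s`, (I.2.23)-regular with `δ_A`, and
SUPPORTED ON DEEP BONDS — print's «dist(supp Ã, ∂Ω) > 2r(L^kε)», p. 412) and `B̃ = B` (the (2.10) bounds of `G_k(Ω,B)` at interior pairs: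
r15's `Ineq210 δ₁ C` on r14's region carrier, and the twice-differentiated per-piece bound in p33's `mixedTermR` shape at interior pairs with
constant `C_M`), `m² > 0`, `a > 0`, `1 ≤ k ≤ K`, `0 < δ₁ ≤ 1`, `(L^kε)|e|s ≤ 1`, every row bond `b₀` FROM AN INTERIOR POINT, and every field
`w = Σ_{j<k}w_j` whose pieces obey single-scale bounds of exponents `a_w > 0` (value, at interior sites) and `a_w − 1` (`D^ε_B`-derivative, at
bonds from interior sites) anchored at `x′`:
`‖(D^ε_B G_k(Ω,B) V_k^Ω(A,B) w)(b₀)‖ ≤ (|e|s·K₁ + L^k|e|δ_A·K₂)·Σ_{j<k}(L^jε)^{a_w−d}exp(−(δ₁/(4L))(L^jε)^{−1}ε|b₀₋ − x′|)` with the torus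
constants `K₁ = seedK1`, `K₂ = seedK2` of `B3Op116MixedSeed.phi_row_srcV_le`.  `V_k^Ω = V_k^{T}` on every field (file R1's
`srcV_region_eq_univ`), THEOREM A separates the sources, §3–§4 bound them, the torus file's §6.1 converts.
[cite: Balaban1983Higgs3, (1.16) p.414, (2.6) p.424, (2.10) p.426, p.412] [cite: Balaban1982Higgs1, (2.23) p.610, (3.14)–(3.16) pp.614–615] [cite: Balaban1983RegularityDecay, Theorem p.573] -/
theorem phi_row_srcV_le_region (hmsq : 0 < msq) (ha : 0 < a) (hk : 1 ≤ k) (hkK : k ≤ P.K) (hδ₁ : 0 < δ₁) (hδ₁1 : δ₁ ≤ 1)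
    (hCst : 0 ≤ Cst) (hCM : 0 ≤ CM) (hs : 0 ≤ s) (hδA : 0 ≤ δA) (ht1 : P.mesh k * (|C.e| * s) ≤ 1)
    (h210B : (regRegionKernels hL1 C Ω B msq a k K₀).Ineq210 δ₁ Cst)
    (hmixB : ∀ (j : ℕ) (μ ν : Fin P.d) (x x' : HiggsLattice.Site P 0), Interior k K₀ Ω x → Interior k K₀ Ω x' →
      mixedTermR C Ω B msq a k j μ ν x x' ≤ CM * (P.mesh j ^ P.d)⁻¹ * Real.exp (-(δ₁ * ((HiggsLattice.Site.tdist x x' : ℝ) / (P.L : ℝ) ^ j))))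
    (hA : ∀ b : HiggsLattice.PBond P 0, |A b| ≤ s)
    (hreg : ∀ (z : HiggsLattice.Site P 0) (μ ν : Fin P.d), |A ⟨z.shift ν, μ⟩ - A ⟨z, μ⟩| ≤ δA)
    (hAS : ∀ b : HiggsLattice.PBond P 0, A b ≠ 0 → DeepBlk k K₀ Ω b.src ∧ DeepBlk k K₀ Ω b.tgt)
    (i₀ : Ix N) {b₀ : HiggsLattice.PBond P 0} (hb₀ : Interior k K₀ Ω b₀.src) (x' : HiggsLattice.Site P 0)
    (w : ScalarField P 0 N) (wp : ℕ → ScalarField P 0 N) (hw : ∑ j ∈ Finset.range k, wp j = w) {aw cw cw' : ℝ} (haw : 0 < aw)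
    (hcw : 0 ≤ cw) (hcw' : 0 ≤ cw')
    (hwv : ∀ (j : ℕ) (y : HiggsLattice.Site P 0), Interior k K₀ Ω y → ‖wp j y‖ ≤ cw * P.mesh j ^ (aw - (P.d : ℝ)) *
      Real.exp (-(δ₁ * (P.mesh j)⁻¹ * (P.mesh 0 * (HiggsLattice.Site.tdist y x' : ℝ)))))
    (hwd : ∀ (j : ℕ) (b : HiggsLattice.PBond P 0), Interior k K₀ Ω b.src → ‖covDeriv C B (wp j) b‖ ≤ cw' * P.mesh j ^ (aw - 1 - (P.d : ℝ)) *
      Real.exp (-(δ₁ * (P.mesh j)⁻¹ * (P.mesh 0 * (HiggsLattice.Site.tdist b.src x' : ℝ))))) :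
    ‖covDeriv C B (propagatorK C Ω B msq a k (srcV C A B k Ω a w)) b₀‖
      ≤ (|C.e| * s * seedK1 P N δ₁ Cst CM a aw cw cw' + (P.L : ℝ) ^ k * (|C.e| * δA) * seedK2 P N δ₁ Cst aw cw) *
          ∑ j ∈ Finset.range k, P.mesh j ^ (aw - (P.d : ℝ)) *
            Real.exp (-(δ₁ / 2 / 2 / P.L * (P.mesh j)⁻¹ * (P.mesh 0 * (HiggsLattice.Site.tdist b₀.src x' : ℝ)))) := by
  -- the four operator bounds (§3, §4)
  have hMD := md_sum_le_region hmsq ha hk hkK hδ₁ hδ₁1 hCst hCM hs hδA h210B hmixB hA hreg hAS i₀ hb₀ x' w wp hw haw hcw hcw' hwv hwd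
  have hDM := dm_sum_le_region hmsq ha hk hkK hδ₁ hδ₁1 hCst hCM hs hδA h210B hmixB hA hreg hAS i₀ hb₀ x' w wp hw haw hcw hcw' hwv hwd
  have hMM := mm_le_region hmsq ha hk hkK hδ₁ hδ₁1 hCst hs h210B hA hAS i₀ hb₀ x' w wp hw haw hcw hwv
  have hAV := avg_le_region hmsq ha hk hkK hδ₁ hδ₁1 hCst hs h210B hA hAS i₀ hb₀ x' w wp hw haw hcw hwv
  -- `V_k^Ω = V_k^T` under the support hypothesis; THEOREM A through the row functional `D^ε_B(·)(b₀)∘G_k(Ω,B)`, then norms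
  rw [srcV_region_eq_univ C A B hAS]
  have hid := map_srcV_univ C A B k a (covDerivAt C B b₀ ∘ₗ propagatorK C Ω B msq a k) w
  simp only [LinearMap.coe_comp, Function.comp_apply, covDerivAt_apply] at hid
  have htot : ‖covDeriv C B (propagatorK C Ω B msq a k (srcV C A B k Finset.univ a w)) b₀‖
      ≤ ‖covDeriv C B (propagatorK C Ω B msq a k (∑ b : HiggsLattice.PBond P 0, srcMD C A B b w)) b₀‖
        + ‖covDeriv C B (propagatorK C Ω B msq a k ((P.mesh 0)⁻¹ • ∑ b : HiggsLattice.PBond P 0, srcDM C A B b w)) b₀‖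
        + ∑ b : HiggsLattice.PBond P 0, ‖covDeriv C B (propagatorK C Ω B msq a k (srcMM C A B b w)) b₀‖
        + |B1.aSeq a P.L k * (P.mesh k)⁻¹ ^ 2| *
          ‖covDeriv C B (propagatorK C Ω B msq a k (avgSrc C A B k w)) b₀‖ := by
    rw [hid]
    refine (norm_sub_le _ _).trans (add_le_add ?_ ?_)
    · rw [norm_neg]
      exact (norm_add_le _ _).trans (add_le_add ((norm_add_le _ _).trans le_rfl) (norm_sum_le _ _))
    · rw [norm_smul, Real.norm_eq_abs]
  -- the four conversions (torus file §6.1) and the bookkeeping of `K₁`, `K₂`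
  refine htot.trans ((add_le_add (add_le_add (add_le_add
    (md_arith hL1 haw hCst hCM hcw hcw' hs hδA hδ₁ b₀.src x' hMD) (dm_arith hL1 haw hCst hCM hcw hcw' hs hδA hδ₁ b₀.src x' hDM))
    (mm_arith hL1 haw hCst hcw hs hδ₁ ht1 b₀.src x' hMM))
    (avg_arith hL1 ha hk haw hCst hcw hs hδ₁ ht1 b₀.src x' (norm_nonneg _) hAV)).trans (le_of_eq ?_))
  simp only [seedK1, seedK2]
  ring

end RowTheorem

/-! ## §6 The instances on a region: `W = G_k(Ω,Ã+B̃) − G_k(Ω,B̃)` on a dipole at an interior bond through one row derivative (THE MIXED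
SEED), `W` on a point source at an interior site, and the value of `W` on a dipole at interior sites (by the symmetry of `W`) -/

section Instances

open scoped Classical

variable {C : ChargeData N} {A B : HiggsLattice.VecField P 0} {msq a : ℝ} {k K₀ : ℕ} {hL1 : 1 < P.L} {δ₁ Cst CM s δA : ℝ}
  {Ω : Finset (HiggsLattice.Site P 0)}

/-- **(2.10) for the `D^ε_B`-differentiated column of a piece of `G_k(Ω,Ã+B̃)` at an interior pair, `j < k`**:
`Σ_i‖(D^ε_BG^η_{(j)}(Ω,Ã+B̃)e_{(y,i)})(b)‖ ≤ ε^dC(1 + e)(L^jε)^{1−d}e^{−δ₁(L^jε)^{−1}ε|b₋ − y|}` — the split `D^ε_B = D^ε_{Ã+B̃} − M_b`; the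
`M_b`-term appears only where `Ã_b ≠ 0`, and then `b₊` is deep, hence interior, so the piece's value column at `(b₊, y)` is available
(`(L^jε)|e|s ≤ (L^kε)|e|s ≤ 1`, one lattice step costs `e`). [cite: Balaban1983Higgs3, (2.6) p.424, (2.10) p.426, p.412] [cite: Balaban1982Higgs1, (3.14) p.614] -/
theorem pdcol_cross_bound_region {j : ℕ} (hjk : j < k) (hδ₁ : 0 < δ₁) (hδ₁1 : δ₁ ≤ 1) (hCst : 0 ≤ Cst) (hs : 0 ≤ s)
    (ht1 : P.mesh k * (|C.e| * s) ≤ 1) (h210AB : (regRegionKernels hL1 C Ω (A + B) msq a k K₀).Ineq210 δ₁ Cst)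
    (hA : ∀ b : HiggsLattice.PBond P 0, |A b| ≤ s)
    (hAS : ∀ b : HiggsLattice.PBond P 0, A b ≠ 0 → DeepBlk k K₀ Ω b.src ∧ DeepBlk k K₀ Ω b.tgt)
    {b : HiggsLattice.PBond P 0} {y : HiggsLattice.Site P 0} (hb : Interior k K₀ Ω b.src) (hy : Interior k K₀ Ω y) :
    ∑ i : Ix N, ‖covDeriv C B (pieceR C Ω (A + B) msq a k j (cb P N 0 (y, i))) b‖
      ≤ (P.mesh 0 ^ P.d * Cst) * (1 + Real.exp 1) * P.mesh j ^ ((1 : ℝ) - (P.d : ℝ)) *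
        Real.exp (-(δ₁ * (P.mesh j)⁻¹ * (P.mesh 0 * (HiggsLattice.Site.tdist b.src y : ℝ)))) := by
  have hes : 0 ≤ |C.e| * s := mul_nonneg (abs_nonneg _) hs
  have hc : 0 ≤ P.mesh 0 ^ P.d * Cst := mul_nonneg (pow_nonneg (P.mesh_pos 0).le _) hCst
  have hm1 : 0 ≤ P.mesh j ^ ((1 : ℝ) - (P.d : ℝ)) := Real.rpow_nonneg (P.mesh_pos j).le _
  have hm2 : 0 ≤ P.mesh j ^ ((2 : ℝ) - (P.d : ℝ)) := Real.rpow_nonneg (P.mesh_pos j).le _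
  set Ex : ℝ := Real.exp (-(δ₁ * (P.mesh j)⁻¹ * (P.mesh 0 * (HiggsLattice.Site.tdist b.src y : ℝ)))) with hEx
  have hE0 : 0 ≤ Ex := Real.exp_nonneg _
  have hD : ∑ i : Ix N, ‖covDeriv C (A + B) (pieceR C Ω (A + B) msq a k j (cb P N 0 (y, i))) b‖
      ≤ (P.mesh 0 ^ P.d * Cst) * P.mesh j ^ ((1 : ℝ) - (P.d : ℝ)) * Ex := pdcolR_le h210AB j hb hy
  by_cases hAb : A b = 0
  · -- no multiplier on `b`: `D^ε_B = D^ε_{A+B}` there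
    have e : ∀ f : ScalarField P 0 N, covDeriv C B f b = covDeriv C (A + B) f b := fun f => by
      rw [covDeriv_add_split C A B f b, mulM_eq_zero C A B hAb, _root_.zero_apply, add_zero]
    simp only [e]
    refine hD.trans ?_
    have h1 : (1 : ℝ) ≤ 1 + Real.exp 1 := le_add_of_nonneg_right (Real.exp_nonneg 1)
    calc (P.mesh 0 ^ P.d * Cst) * P.mesh j ^ ((1 : ℝ) - (P.d : ℝ)) * Ex
        = (P.mesh 0 ^ P.d * Cst) * 1 * P.mesh j ^ ((1 : ℝ) - (P.d : ℝ)) * Ex := by ring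
      _ ≤ (P.mesh 0 ^ P.d * Cst) * (1 + Real.exp 1) * P.mesh j ^ ((1 : ℝ) - (P.d : ℝ)) * Ex :=
          mul_le_mul_of_nonneg_right (mul_le_mul_of_nonneg_right (mul_le_mul_of_nonneg_left h1 hc) hm1) hE0
  · -- `b` carries `Ã`: `b₊` is deep, hence interior; the split `D^ε_B = D^ε_{A+B} − M_b`
    have hbt : Interior k K₀ Ω b.tgt := (hAS b hAb).2.interior
    have hshift : Real.exp (-(δ₁ * (P.mesh j)⁻¹ * (P.mesh 0 * (HiggsLattice.Site.tdist b.tgt y : ℝ)))) ≤ Real.exp 1 * Ex :=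
      bump_shift_le' hδ₁.le hδ₁1 j b.src y b.dir
    have hmesh : P.mesh j ^ ((2 : ℝ) - (P.d : ℝ)) = P.mesh j * P.mesh j ^ ((1 : ℝ) - (P.d : ℝ)) := by
      rw [show (2 : ℝ) - (P.d : ℝ) = 1 + ((1 : ℝ) - (P.d : ℝ)) by ring, ← mesh_rpow_add, Real.rpow_one]
    have hjle : P.mesh j * (|C.e| * s) ≤ 1 :=
      (mul_le_mul_of_nonneg_right (B3Ineq210RegularTorus.mesh_mono P hjk.le) hes).trans ht1
    have hV : ∑ i : Ix N, ‖pieceR C Ω (A + B) msq a k j (cb P N 0 (y, i)) b.tgt‖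
        ≤ (P.mesh 0 ^ P.d * Cst) * P.mesh j ^ ((2 : ℝ) - (P.d : ℝ)) * (Real.exp 1 * Ex) :=
      (pcolR_le h210AB j hbt hy).trans (mul_le_mul_of_nonneg_left hshift (mul_nonneg hc hm2))
    calc ∑ i : Ix N, ‖covDeriv C B (pieceR C Ω (A + B) msq a k j (cb P N 0 (y, i))) b‖
        ≤ ∑ i : Ix N, (‖covDeriv C (A + B) (pieceR C Ω (A + B) msq a k j (cb P N 0 (y, i))) b‖
            + |C.e| * s * ‖pieceR C Ω (A + B) msq a k j (cb P N 0 (y, i)) b.tgt‖) :=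
          Finset.sum_le_sum fun i _ => norm_covDeriv_le_add_split C A B (hA b) _
      _ = (∑ i : Ix N, ‖covDeriv C (A + B) (pieceR C Ω (A + B) msq a k j (cb P N 0 (y, i))) b‖)
            + |C.e| * s * ∑ i : Ix N, ‖pieceR C Ω (A + B) msq a k j (cb P N 0 (y, i)) b.tgt‖ := by
          rw [Finset.sum_add_distrib, Finset.mul_sum]
      _ ≤ (P.mesh 0 ^ P.d * Cst) * P.mesh j ^ ((1 : ℝ) - (P.d : ℝ)) * Ex
            + |C.e| * s * ((P.mesh 0 ^ P.d * Cst) * P.mesh j ^ ((2 : ℝ) - (P.d : ℝ)) * (Real.exp 1 * Ex)) :=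
          add_le_add hD (mul_le_mul_of_nonneg_left hV hes)
      _ = (P.mesh 0 ^ P.d * Cst) * P.mesh j ^ ((1 : ℝ) - (P.d : ℝ)) * Ex * (1 + (P.mesh j * (|C.e| * s)) * Real.exp 1) := by
          rw [hmesh]; ring
      _ ≤ (P.mesh 0 ^ P.d * Cst) * P.mesh j ^ ((1 : ℝ) - (P.d : ℝ)) * Ex * (1 + 1 * Real.exp 1) :=
          mul_le_mul_of_nonneg_left (add_le_add le_rfl (mul_le_mul_of_nonneg_right hjle (Real.exp_nonneg 1)))
            (mul_nonneg (mul_nonneg hc hm1) hE0)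
      _ = _ := by ring

/-- **The VALUE of a piece of `G_k(Ω,Ã+B̃)` on the `B`-dipole `dip^B_{b′}Y` at an INTERIOR bond `b′`, read at an interior site, `j < k`**
(piece symmetry `norm_pieceR_dip_apply_le` + `pdcol_cross_bound_region`): exponent `a_w = 1`, anchor `b′₋`, the torus constant.
[cite: Balaban1983Higgs3, (2.6) p.424, (2.10) p.426, p.412] [cite: Balaban1982Higgs1, (1.7) p.605, (3.14) p.614] -/
theorem norm_pieceR_dipB_le_region {j : ℕ} (hjk : j < k) (hδ₁ : 0 < δ₁) (hδ₁1 : δ₁ ≤ 1) (hCst : 0 ≤ Cst) (hs : 0 ≤ s)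
    (ht1 : P.mesh k * (|C.e| * s) ≤ 1) (h210AB : (regRegionKernels hL1 C Ω (A + B) msq a k K₀).Ineq210 δ₁ Cst)
    (hA : ∀ b : HiggsLattice.PBond P 0, |A b| ≤ s)
    (hAS : ∀ b : HiggsLattice.PBond P 0, A b ≠ 0 → DeepBlk k K₀ Ω b.src ∧ DeepBlk k K₀ Ω b.tgt)
    {b' : HiggsLattice.PBond P 0} (hb' : Interior k K₀ Ω b'.src) (Y : E N) {y : HiggsLattice.Site P 0} (hy : Interior k K₀ Ω y) :
    ‖pieceR C Ω (A + B) msq a k j (dip C B b' Y) y‖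
      ≤ (P.mesh 0 * ‖Y‖ * ((P.mesh 0 ^ P.d * Cst) * (1 + Real.exp 1))) * P.mesh j ^ ((1 : ℝ) - (P.d : ℝ)) *
          Real.exp (-(δ₁ * (P.mesh j)⁻¹ * (P.mesh 0 * (HiggsLattice.Site.tdist y b'.src : ℝ)))) := by
  have h := norm_pieceR_dip_apply_le C Ω (A + B) msq a B k j b' Y y
  have h2 := pdcol_cross_bound_region hjk hδ₁ hδ₁1 hCst hs ht1 h210AB hA hAS hb' hy
  rw [tdist_comm y b'.src]
  calc ‖pieceR C Ω (A + B) msq a k j (dip C B b' Y) y‖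
      ≤ P.mesh 0 * ‖Y‖ * ∑ i : Ix N, ‖covDeriv C B (pieceR C Ω (A + B) msq a k j (cb P N 0 (y, i))) b'‖ := h
    _ ≤ P.mesh 0 * ‖Y‖ * ((P.mesh 0 ^ P.d * Cst) * (1 + Real.exp 1) * P.mesh j ^ ((1 : ℝ) - (P.d : ℝ)) *
          Real.exp (-(δ₁ * (P.mesh j)⁻¹ * (P.mesh 0 * (HiggsLattice.Site.tdist b'.src y : ℝ))))) :=
        mul_le_mul_of_nonneg_left h2 (mul_nonneg (P.mesh_pos 0).le (norm_nonneg _))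
    _ = _ := by ring

/-- **The `D^ε_B`-DERIVATIVE of a piece of `G_k(Ω,Ã+B̃)` on the `B`-dipole at an interior bond `b′`, read at a bond `b` from an interior
point, `j < k`** — the torus constant of `B3Op116MixedSeed.norm_covDeriv_pieceR_dipB_le`: `D^ε_B = D^ε_{Ã+B̃} − M_b` (the `M_b`-term only
where `Ã_b ≠ 0`, `b₊` deep), `dip^B = dip^{Ã+B̃} + δ_{b′₊}v` with `v = U(−B_{b′})Y − U(−(Ã+B̃)_{b′})Y`, which VANISHES unless `Ã_{b′} ≠ 0`
(and then `b′₊` is deep), and the twice-differentiated piece in its own background at the interior pair `(b₋, b′₋)`.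
[cite: Balaban1983Higgs3, (2.6) p.424, (2.10) p.426, p.412] [cite: Balaban1982Higgs1, (1.7) p.605, (3.14) p.614] -/
theorem norm_covDeriv_pieceR_dipB_le_region {j : ℕ} (hjk : j < k) (hδ₁ : 0 < δ₁) (hδ₁1 : δ₁ ≤ 1) (hCst : 0 ≤ Cst)
    (hCM : 0 ≤ CM) (hs : 0 ≤ s) (ht1 : P.mesh k * (|C.e| * s) ≤ 1)
    (h210AB : (regRegionKernels hL1 C Ω (A + B) msq a k K₀).Ineq210 δ₁ Cst)
    (hmixAB : ∀ (j : ℕ) (μ ν : Fin P.d) (x x' : HiggsLattice.Site P 0), Interior k K₀ Ω x → Interior k K₀ Ω x' →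
      mixedTermR C Ω (A + B) msq a k j μ ν x x'
        ≤ CM * (P.mesh j ^ P.d)⁻¹ * Real.exp (-(δ₁ * ((HiggsLattice.Site.tdist x x' : ℝ) / (P.L : ℝ) ^ j))))
    (hA : ∀ b : HiggsLattice.PBond P 0, |A b| ≤ s)
    (hAS : ∀ b : HiggsLattice.PBond P 0, A b ≠ 0 → DeepBlk k K₀ Ω b.src ∧ DeepBlk k K₀ Ω b.tgt)
    {b' : HiggsLattice.PBond P 0} (hb' : Interior k K₀ Ω b'.src) (Y : E N) {b : HiggsLattice.PBond P 0} (hb : Interior k K₀ Ω b.src) :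
    ‖covDeriv C B (pieceR C Ω (A + B) msq a k j (dip C B b' Y)) b‖
      ≤ (P.mesh 0 * ‖Y‖ * (P.mesh 0 ^ P.d * CM + (P.mesh 0 ^ P.d * Cst) * Real.exp 1
            + (P.mesh 0 ^ P.d * Cst) * (1 + Real.exp 1) * Real.exp 1)) * P.mesh j ^ ((1 : ℝ) - 1 - (P.d : ℝ)) *
          Real.exp (-(δ₁ * (P.mesh j)⁻¹ * (P.mesh 0 * (HiggsLattice.Site.tdist b.src b'.src : ℝ)))) := by
  have hε := P.mesh_pos 0
  have hes : 0 ≤ |C.e| * s := mul_nonneg (abs_nonneg _) hs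
  have hc : 0 ≤ P.mesh 0 ^ P.d * Cst := mul_nonneg (pow_nonneg hε.le _) hCst
  have hcM : 0 ≤ P.mesh 0 ^ P.d * CM := mul_nonneg (pow_nonneg hε.le _) hCM
  have hm1 : 0 ≤ P.mesh j ^ ((1 : ℝ) - (P.d : ℝ)) := Real.rpow_nonneg (P.mesh_pos j).le _
  have hm0' : 0 ≤ P.mesh j ^ ((0 : ℝ) - (P.d : ℝ)) := Real.rpow_nonneg (P.mesh_pos j).le _
  have hjle : P.mesh j * (|C.e| * s) ≤ 1 :=
    (mul_le_mul_of_nonneg_right (B3Ineq210RegularTorus.mesh_mono P hjk.le) hes).trans ht1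
  set Ex : ℝ := Real.exp (-(δ₁ * (P.mesh j)⁻¹ * (P.mesh 0 * (HiggsLattice.Site.tdist b.src b'.src : ℝ)))) with hEx
  have hE0 : 0 ≤ Ex := Real.exp_nonneg _
  have hY := norm_nonneg Y
  set v : E N := C.U (P.mesh 0) (-(B b')) Y - C.U (P.mesh 0) (-((A + B) b')) Y with hv
  have hvn : ‖v‖ ≤ P.mesh 0 * (|C.e| * s) * ‖Y‖ := norm_U_sub_U_add_le (hA b') Y
  -- `dip^B = dip^{A+B} + δ_{b′₊}v`
  have h2 : pieceR C Ω (A + B) msq a k j (dip C B b' Y)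
      = pieceR C Ω (A + B) msq a k j (dip C (A + B) b' Y) + pieceR C Ω (A + B) msq a k j (Pi.single b'.tgt v) := by
    rw [dip_eq_dip_add_single, map_add]
  -- the twice-differentiated piece in its own background, at the interior pair `(b₋, b′₋)`
  have h3 : ‖covDeriv C (A + B) (pieceR C Ω (A + B) msq a k j (dip C (A + B) b' Y)) b‖
      ≤ ‖Y‖ * (P.mesh 0 * ((P.mesh 0 ^ P.d * CM) * P.mesh j ^ ((0 : ℝ) - (P.d : ℝ)) * Ex)) := by
    have h := norm_mapE_dip_le (C := C) (B := A + B) (covDerivAt C (A + B) b ∘ₗ pieceR C Ω (A + B) msq a k j) b' Y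
    simp only [LinearMap.coe_comp, Function.comp_apply, covDerivAt_apply] at h
    refine h.trans (mul_le_mul_of_nonneg_left ?_ hY)
    have h' : ∑ i : Ix N, ‖covDeriv C (A + B) (pieceR C Ω (A + B) msq a k j (dip C (A + B) b' (onb N i))) b‖
        = P.mesh 0 * ((P.mesh 0)⁻¹ * ∑ i : Ix N, ‖covDeriv C (A + B) (pieceR C Ω (A + B) msq a k j (dip C (A + B) b' (onb N i))) b‖) := by
      rw [← mul_assoc, mul_inv_cancel₀ hε.ne', one_mul]
    rw [h']
    exact mul_le_mul_of_nonneg_left (pmixR_le hmixAB j hb hb') hε.le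
  -- the differentiated column at `b′₊` (only where `Ã_{b′} ≠ 0`, `b′₊` deep), shifted back to `b′₋`
  have h4 : ‖covDeriv C (A + B) (pieceR C Ω (A + B) msq a k j (Pi.single b'.tgt v)) b‖
      ≤ (P.mesh 0 * (|C.e| * s) * ‖Y‖) * ((P.mesh 0 ^ P.d * Cst) * P.mesh j ^ ((1 : ℝ) - (P.d : ℝ)) * (Real.exp 1 * Ex)) := by
    by_cases hAb' : A b' = 0
    · have hv0 : v = 0 := by rw [hv, Pi.add_apply, hAb', zero_add, sub_self]
      rw [hv0, Pi.single_zero, map_zero, B3Ineq210RegularTorus.covDeriv_zero'', norm_zero]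
      exact mul_nonneg (by positivity) (mul_nonneg (mul_nonneg hc hm1) (mul_nonneg (Real.exp_nonneg 1) hE0))
    · have hb't : Interior k K₀ Ω b'.tgt := (hAS b' hAb').2.interior
      refine (B3Ineq210MixedRegularTorus.norm_covDeriv_apply_single_le C (A + B) (pieceR C Ω (A + B) msq a k j) b'.tgt v b).trans ?_
      refine mul_le_mul hvn ?_ (Finset.sum_nonneg fun _ _ => norm_nonneg _) (by positivity)
      refine (pdcolR_le h210AB j hb hb't).trans ?_
      exact mul_le_mul_of_nonneg_left (bump_shift_le hδ₁.le hδ₁1 j b.src b'.src b'.dir) (mul_nonneg hc hm1)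
  have h6 : ‖covDeriv C (A + B) (pieceR C Ω (A + B) msq a k j (dip C B b' Y)) b‖
      ≤ ‖Y‖ * (P.mesh 0 * ((P.mesh 0 ^ P.d * CM) * P.mesh j ^ ((0 : ℝ) - (P.d : ℝ)) * Ex))
        + (P.mesh 0 * (|C.e| * s) * ‖Y‖) * ((P.mesh 0 ^ P.d * Cst) * P.mesh j ^ ((1 : ℝ) - (P.d : ℝ)) * (Real.exp 1 * Ex)) := by
    rw [h2, B3Ineq210RegularTorus.covDeriv_add'']
    exact (norm_add_le _ _).trans (add_le_add h3 h4)
  -- the split `D^ε_B = D^ε_{A+B} − M_b`: the `M_b`-term (the value at `b₊`, shifted back to `b₋`) only where `Ã_b ≠ 0`, `b₊` deep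
  have hT3 : 0 ≤ (P.mesh 0 * ‖Y‖ * ((P.mesh 0 ^ P.d * Cst) * (1 + Real.exp 1))) * P.mesh j ^ ((1 : ℝ) - (P.d : ℝ)) * (Real.exp 1 * Ex) :=
    mul_nonneg (mul_nonneg (by positivity) hm1) (mul_nonneg (Real.exp_nonneg 1) hE0)
  have h15 : ‖covDeriv C B (pieceR C Ω (A + B) msq a k j (dip C B b' Y)) b‖
      ≤ ‖Y‖ * (P.mesh 0 * ((P.mesh 0 ^ P.d * CM) * P.mesh j ^ ((0 : ℝ) - (P.d : ℝ)) * Ex))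
        + (P.mesh 0 * (|C.e| * s) * ‖Y‖) * ((P.mesh 0 ^ P.d * Cst) * P.mesh j ^ ((1 : ℝ) - (P.d : ℝ)) * (Real.exp 1 * Ex))
        + |C.e| * s * ((P.mesh 0 * ‖Y‖ * ((P.mesh 0 ^ P.d * Cst) * (1 + Real.exp 1))) * P.mesh j ^ ((1 : ℝ) - (P.d : ℝ)) *
          (Real.exp 1 * Ex)) := by
    by_cases hAb : A b = 0
    · have e : covDeriv C B (pieceR C Ω (A + B) msq a k j (dip C B b' Y)) b
          = covDeriv C (A + B) (pieceR C Ω (A + B) msq a k j (dip C B b' Y)) b := by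
        rw [covDeriv_add_split C A B _ b, mulM_eq_zero C A B hAb, _root_.zero_apply, add_zero]
      rw [e]
      exact h6.trans (le_add_of_nonneg_right (mul_nonneg hes hT3))
    · have hbt : Interior k K₀ Ω b.tgt := (hAS b hAb).2.interior
      have h5 : ‖pieceR C Ω (A + B) msq a k j (dip C B b' Y) b.tgt‖
          ≤ (P.mesh 0 * ‖Y‖ * ((P.mesh 0 ^ P.d * Cst) * (1 + Real.exp 1))) * P.mesh j ^ ((1 : ℝ) - (P.d : ℝ)) * (Real.exp 1 * Ex) := by
        refine (norm_pieceR_dipB_le_region hjk hδ₁ hδ₁1 hCst hs ht1 h210AB hA hAS hb' Y hbt).trans ?_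
        exact mul_le_mul_of_nonneg_left (bump_shift_le' hδ₁.le hδ₁1 j b.src b'.src b.dir) (by positivity)
      exact (norm_covDeriv_le_add_split C A B (hA b) _).trans (add_le_add h6 (mul_le_mul_of_nonneg_left h5 hes))
  -- exponents: `(L^jε)^{1−d} = (L^jε)·(L^jε)^{0−d}`
  have hm10 : P.mesh j ^ ((1 : ℝ) - (P.d : ℝ)) = P.mesh j * P.mesh j ^ ((1 : ℝ) - 1 - (P.d : ℝ)) := by
    rw [show (1 : ℝ) - (P.d : ℝ) = 1 + ((1 : ℝ) - 1 - (P.d : ℝ)) by ring, ← mesh_rpow_add, Real.rpow_one]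
  have hm00 : P.mesh j ^ ((0 : ℝ) - (P.d : ℝ)) = P.mesh j ^ ((1 : ℝ) - 1 - (P.d : ℝ)) := by norm_num
  calc ‖covDeriv C B (pieceR C Ω (A + B) msq a k j (dip C B b' Y)) b‖
      ≤ _ := h15
    _ = P.mesh 0 * ‖Y‖ * P.mesh j ^ ((1 : ℝ) - 1 - (P.d : ℝ)) * Ex *
          (P.mesh 0 ^ P.d * CM + (P.mesh j * (|C.e| * s)) * ((P.mesh 0 ^ P.d * Cst) * Real.exp 1
            + (P.mesh 0 ^ P.d * Cst) * (1 + Real.exp 1) * Real.exp 1)) := by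
        rw [hm10, hm00]; ring
    _ ≤ P.mesh 0 * ‖Y‖ * P.mesh j ^ ((1 : ℝ) - 1 - (P.d : ℝ)) * Ex *
          (P.mesh 0 ^ P.d * CM + 1 * ((P.mesh 0 ^ P.d * Cst) * Real.exp 1
            + (P.mesh 0 ^ P.d * Cst) * (1 + Real.exp 1) * Real.exp 1)) :=
        mul_le_mul_of_nonneg_left (add_le_add le_rfl (mul_le_mul_of_nonneg_right hjle
          (by positivity : (0 : ℝ) ≤ (P.mesh 0 ^ P.d * Cst) * Real.exp 1 + (P.mesh 0 ^ P.d * Cst) * (1 + Real.exp 1) * Real.exp 1)))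
          (mul_nonneg (mul_nonneg (mul_nonneg hε.le hY) (Real.rpow_nonneg (P.mesh_pos j).le _)) hE0)
    _ = _ := by ring

/-- **THE MIXED SEED ON A REGION (row side).**  For a region `Ω`, `Ã = A` small, regular and supported on deep bonds, `B̃ = B` and `Ã + B̃`
carrying the (2.10) bounds at interior pairs and their twice-differentiated form, `m² > 0`, `a > 0`, `1 ≤ k ≤ K`, `0 < δ₁ ≤ 1`,
`(L^kε)|e|s ≤ 1`, every row bond `b₀` from an interior point, every INTERIOR dipole bond `b′` and charge `Y`:
`‖(D^ε_B[G_k(Ω,Ã+B̃) − G_k(Ω,B̃)]dip^B_{b′}Y)(b₀)‖ ≤ (|e|s·K₁ + L^k|e|δ_A·K₂)·Σ_{j<k}(L^jε)^{1−d}exp(−(δ₁/(4L))(L^jε)^{−1}ε|b₀₋ − b′₋|)` with the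
torus constants of `B3Op116MixedSeed.mixed_seed_le`.  `W = G_BV_kG_{A+B}` on `Ω` ((I.3.44), `eq344_model`), THEOREM A (`opV_apply_eq_srcV`),
the row theorem on the region applied to `w = G_k(Ω,Ã+B̃)dip^B_{b′}Y = Σ_{j<k}G^η_{(j)}dip^B_{b′}Y`.
[cite: Balaban1983Higgs3, (1.16) p.414, (2.6) p.424, (2.10) p.426, p.412] [cite: Balaban1982Higgs1, (3.16) p.615, (3.44) p.619] [cite: Balaban1983RegularityDecay, Theorem p.573] -/
theorem mixed_seed_le_region (hmsq : 0 < msq) (ha : 0 < a) (hk : 1 ≤ k) (hkK : k ≤ P.K) (hδ₁ : 0 < δ₁) (hδ₁1 : δ₁ ≤ 1)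
    (hCst : 0 ≤ Cst) (hCM : 0 ≤ CM) (hs : 0 ≤ s) (hδA : 0 ≤ δA) (ht1 : P.mesh k * (|C.e| * s) ≤ 1)
    (h210B : (regRegionKernels hL1 C Ω B msq a k K₀).Ineq210 δ₁ Cst)
    (hmixB : ∀ (j : ℕ) (μ ν : Fin P.d) (x x' : HiggsLattice.Site P 0), Interior k K₀ Ω x → Interior k K₀ Ω x' →
      mixedTermR C Ω B msq a k j μ ν x x' ≤ CM * (P.mesh j ^ P.d)⁻¹ * Real.exp (-(δ₁ * ((HiggsLattice.Site.tdist x x' : ℝ) / (P.L : ℝ) ^ j))))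
    (h210AB : (regRegionKernels hL1 C Ω (A + B) msq a k K₀).Ineq210 δ₁ Cst)
    (hmixAB : ∀ (j : ℕ) (μ ν : Fin P.d) (x x' : HiggsLattice.Site P 0), Interior k K₀ Ω x → Interior k K₀ Ω x' →
      mixedTermR C Ω (A + B) msq a k j μ ν x x'
        ≤ CM * (P.mesh j ^ P.d)⁻¹ * Real.exp (-(δ₁ * ((HiggsLattice.Site.tdist x x' : ℝ) / (P.L : ℝ) ^ j))))
    (hA : ∀ b : HiggsLattice.PBond P 0, |A b| ≤ s)
    (hreg : ∀ (z : HiggsLattice.Site P 0) (μ ν : Fin P.d), |A ⟨z.shift ν, μ⟩ - A ⟨z, μ⟩| ≤ δA)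
    (hAS : ∀ b : HiggsLattice.PBond P 0, A b ≠ 0 → DeepBlk k K₀ Ω b.src ∧ DeepBlk k K₀ Ω b.tgt)
    (i₀ : Ix N) {b₀ b' : HiggsLattice.PBond P 0} (hb₀ : Interior k K₀ Ω b₀.src) (hb' : Interior k K₀ Ω b'.src) (Y : E N) :
    ‖covDeriv C B ((propagatorK C Ω (A + B) msq a k - propagatorK C Ω B msq a k) (dip C B b' Y)) b₀‖
      ≤ (|C.e| * s * seedK1 P N δ₁ Cst CM a 1 (P.mesh 0 * ‖Y‖ * ((P.mesh 0 ^ P.d * Cst) * (1 + Real.exp 1)))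
              (P.mesh 0 * ‖Y‖ * (P.mesh 0 ^ P.d * CM + (P.mesh 0 ^ P.d * Cst) * Real.exp 1
                + (P.mesh 0 ^ P.d * Cst) * (1 + Real.exp 1) * Real.exp 1))
          + (P.L : ℝ) ^ k * (|C.e| * δA) * seedK2 P N δ₁ Cst 1 (P.mesh 0 * ‖Y‖ * ((P.mesh 0 ^ P.d * Cst) * (1 + Real.exp 1)))) *
        ∑ j ∈ Finset.range k, P.mesh j ^ ((1 : ℝ) - (P.d : ℝ)) *
          Real.exp (-(δ₁ / 2 / 2 / P.L * (P.mesh j)⁻¹ * (P.mesh 0 * (HiggsLattice.Site.tdist b₀.src b'.src : ℝ)))) := by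
  have hL1' : (1 : ℝ) < (P.L : ℝ) := by exact_mod_cast hL1
  have hε := P.mesh_pos 0
  have hak : 0 ≤ B1.aSeq a P.L k := (B1.aSeq_pos ha hL1' hk).le
  have hcw0 : 0 ≤ P.mesh 0 * ‖Y‖ * ((P.mesh 0 ^ P.d * Cst) * (1 + Real.exp 1)) := by positivity
  have hcw0' : 0 ≤ P.mesh 0 * ‖Y‖ * (P.mesh 0 ^ P.d * CM + (P.mesh 0 ^ P.d * Cst) * Real.exp 1
      + (P.mesh 0 ^ P.d * Cst) * (1 + Real.exp 1) * Real.exp 1) := by positivity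
  -- (I.3.44) and THEOREM A on `Ω`: `(G_{A+B} − G_B)φ = G_B V_k (G_{A+B}φ) = G_B srcV^Ω(G_{A+B}φ)`
  have hW : (propagatorK C Ω (A + B) msq a k - propagatorK C Ω B msq a k) (dip C B b' Y)
      = propagatorK C Ω B msq a k (srcV C A B k Ω a (propagatorK C Ω (A + B) msq a k (dip C B b' Y))) := by
    rw [sub_eq_iff_eq_add'.mpr (B3Eq116TwoSidedExpansion.eq344_model C Ω A B a k hmsq hak), Module.End.mul_apply,
      Module.End.mul_apply, B3Op116SourceForm.opV_apply_eq_srcV]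
  rw [hW]
  -- the pieces (2.6) of `w = G_k(Ω,A+B)φ`
  have hw : ∑ j ∈ Finset.range k, (fun j => if j < k then pieceR C Ω (A + B) msq a k j (dip C B b' Y) else 0) j
      = propagatorK C Ω (A + B) msq a k (dip C B b' Y) := by
    rw [propagatorK_apply_eq_sum_piecesR C msq a k (A + B) hmsq ha hL1 hk hkK]
    exact Finset.sum_congr rfl fun j hj => if_pos (Finset.mem_range.1 hj)
  refine phi_row_srcV_le_region hmsq ha hk hkK hδ₁ hδ₁1 hCst hCM hs hδA ht1 h210B hmixB hA hreg hAS i₀ hb₀ b'.src _ _ hw one_pos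
    hcw0 hcw0' (fun j y hy => ?_) (fun j b hb => ?_)
  · by_cases hjk : j < k
    · simp only [if_pos hjk]
      exact norm_pieceR_dipB_le_region hjk hδ₁ hδ₁1 hCst hs ht1 h210AB hA hAS hb' Y hy
    · simp only [if_neg hjk, Pi.zero_apply, norm_zero]
      exact bump_nonneg hcw0 _ _ _
  · by_cases hjk : j < k
    · simp only [if_pos hjk]
      exact norm_covDeriv_pieceR_dipB_le_region hjk hδ₁ hδ₁1 hCst hCM hs ht1 h210AB hmixAB hA hAS hb' Y hb
    · simp only [if_neg hjk, B3Ineq210RegularTorus.covDeriv_zero'', norm_zero]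
      exact bump_nonneg hcw0' _ _ _

/-- **The row of `W = G_k(Ω,Ã+B̃) − G_k(Ω,B̃)` on a point source at an INTERIOR site through `D^ε_B` at a bond from an interior point** (value
exponent `a_w = 2`): the torus constants of `B3Op116MixedSeed.deriv_W_single_le` — the pieces of `w = G_k(Ω,Ã+B̃)e_{(y,i)}` are single
columns (`pcolR_le`) with `D^ε_B`-differentiated columns `pdcol_cross_bound_region`, at interior points.
[cite: Balaban1983Higgs3, (1.16) p.414, (2.6) p.424, (2.10) p.426, p.412] [cite: Balaban1982Higgs1, (3.16) p.615, (3.44) p.619] -/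
theorem deriv_W_single_le_region (hmsq : 0 < msq) (ha : 0 < a) (hk : 1 ≤ k) (hkK : k ≤ P.K) (hδ₁ : 0 < δ₁) (hδ₁1 : δ₁ ≤ 1)
    (hCst : 0 ≤ Cst) (hCM : 0 ≤ CM) (hs : 0 ≤ s) (hδA : 0 ≤ δA) (ht1 : P.mesh k * (|C.e| * s) ≤ 1)
    (h210B : (regRegionKernels hL1 C Ω B msq a k K₀).Ineq210 δ₁ Cst)
    (hmixB : ∀ (j : ℕ) (μ ν : Fin P.d) (x x' : HiggsLattice.Site P 0), Interior k K₀ Ω x → Interior k K₀ Ω x' →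
      mixedTermR C Ω B msq a k j μ ν x x' ≤ CM * (P.mesh j ^ P.d)⁻¹ * Real.exp (-(δ₁ * ((HiggsLattice.Site.tdist x x' : ℝ) / (P.L : ℝ) ^ j))))
    (h210AB : (regRegionKernels hL1 C Ω (A + B) msq a k K₀).Ineq210 δ₁ Cst)
    (hA : ∀ b : HiggsLattice.PBond P 0, |A b| ≤ s)
    (hreg : ∀ (z : HiggsLattice.Site P 0) (μ ν : Fin P.d), |A ⟨z.shift ν, μ⟩ - A ⟨z, μ⟩| ≤ δA)
    (hAS : ∀ b : HiggsLattice.PBond P 0, A b ≠ 0 → DeepBlk k K₀ Ω b.src ∧ DeepBlk k K₀ Ω b.tgt)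
    (i₀ : Ix N) {b₀ : HiggsLattice.PBond P 0} (hb₀ : Interior k K₀ Ω b₀.src) {y : HiggsLattice.Site P 0} (hy : Interior k K₀ Ω y)
    (i : Ix N) :
    ‖covDeriv C B ((propagatorK C Ω (A + B) msq a k - propagatorK C Ω B msq a k) (cb P N 0 (y, i))) b₀‖
      ≤ (|C.e| * s * seedK1 P N δ₁ Cst CM a 2 (P.mesh 0 ^ P.d * Cst) ((P.mesh 0 ^ P.d * Cst) * (1 + Real.exp 1))
          + (P.L : ℝ) ^ k * (|C.e| * δA) * seedK2 P N δ₁ Cst 2 (P.mesh 0 ^ P.d * Cst)) *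
        ∑ j ∈ Finset.range k, P.mesh j ^ ((2 : ℝ) - (P.d : ℝ)) *
          Real.exp (-(δ₁ / 2 / 2 / P.L * (P.mesh j)⁻¹ * (P.mesh 0 * (HiggsLattice.Site.tdist b₀.src y : ℝ)))) := by
  have hL1' : (1 : ℝ) < (P.L : ℝ) := by exact_mod_cast hL1
  have hε := P.mesh_pos 0
  have hak : 0 ≤ B1.aSeq a P.L k := (B1.aSeq_pos ha hL1' hk).le
  have hcw0 : 0 ≤ P.mesh 0 ^ P.d * Cst := by positivity
  have hcw0' : 0 ≤ (P.mesh 0 ^ P.d * Cst) * (1 + Real.exp 1) := by positivity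
  have hW : (propagatorK C Ω (A + B) msq a k - propagatorK C Ω B msq a k) (cb P N 0 (y, i))
      = propagatorK C Ω B msq a k (srcV C A B k Ω a (propagatorK C Ω (A + B) msq a k (cb P N 0 (y, i)))) := by
    rw [sub_eq_iff_eq_add'.mpr (B3Eq116TwoSidedExpansion.eq344_model C Ω A B a k hmsq hak), Module.End.mul_apply,
      Module.End.mul_apply, B3Op116SourceForm.opV_apply_eq_srcV]
  rw [hW]
  have hw : ∑ j ∈ Finset.range k, (fun j => if j < k then pieceR C Ω (A + B) msq a k j (cb P N 0 (y, i)) else 0) j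
      = propagatorK C Ω (A + B) msq a k (cb P N 0 (y, i)) := by
    rw [propagatorK_apply_eq_sum_piecesR C msq a k (A + B) hmsq ha hL1 hk hkK]
    exact Finset.sum_congr rfl fun j hj => if_pos (Finset.mem_range.1 hj)
  refine phi_row_srcV_le_region hmsq ha hk hkK hδ₁ hδ₁1 hCst hCM hs hδA ht1 h210B hmixB hA hreg hAS i₀ hb₀ y _ _ hw two_pos hcw0
    hcw0' (fun j x hx => ?_) (fun j b hb => ?_)
  · by_cases hjk : j < k
    · simp only [if_pos hjk]
      refine le_trans ?_ (pcolR_le h210AB j hx hy)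
      exact Finset.single_le_sum (f := fun i' : Ix N => ‖pieceR C Ω (A + B) msq a k j (cb P N 0 (y, i')) x‖)
        (fun _ _ => norm_nonneg _) (Finset.mem_univ i)
    · simp only [if_neg hjk, Pi.zero_apply, norm_zero]
      exact bump_nonneg hcw0 _ _ _
  · by_cases hjk : j < k
    · simp only [if_pos hjk]
      rw [show (2 : ℝ) - 1 - (P.d : ℝ) = (1 : ℝ) - (P.d : ℝ) by ring]
      refine le_trans ?_ (pdcol_cross_bound_region hjk hδ₁ hδ₁1 hCst hs ht1 h210AB hA hAS hb hy)
      exact Finset.single_le_sum (f := fun i' : Ix N => ‖covDeriv C B (pieceR C Ω (A + B) msq a k j (cb P N 0 (y, i'))) b‖)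
        (fun _ _ => norm_nonneg _) (Finset.mem_univ i)
    · simp only [if_neg hjk, B3Ineq210RegularTorus.covDeriv_zero'', norm_zero]
      exact bump_nonneg hcw0' _ _ _

/-- **`W = G_k(Ω,Ã+B̃) − G_k(Ω,B̃)` is symmetric on every `Ω`, so its value on a dipole is `ε`× a row derivative**:
`⟨(Wdip^{X′}_bY)(x), v⟩ = ε⟨Y, (D^ε_{X′}Wδ_xv)(b)⟩` (r14's `inner_propagatorK_dip_apply` for both propagators). [cite: Balaban1982Higgs1, (1.7) p.605, (2.20) p.610] -/
theorem inner_W_dip_apply (X' : HiggsLattice.VecField P 0) (b : HiggsLattice.PBond P 0) (Y v : E N) (x : HiggsLattice.Site P 0) :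
    ⟪(propagatorK C Ω (A + B) msq a k - propagatorK C Ω B msq a k) (dip C X' b Y) x, v⟫_ℝ
      = P.mesh 0 * ⟪Y, covDeriv C X'
          ((propagatorK C Ω (A + B) msq a k - propagatorK C Ω B msq a k) (Pi.single x v)) b⟫_ℝ := by
  have covDeriv_sub : ∀ (u w : ScalarField P 0 N), covDeriv C X' (u - w) b = covDeriv C X' u b - covDeriv C X' w b := by
    intro u w
    unfold covDeriv
    rw [Pi.sub_apply, Pi.sub_apply, map_sub, ← smul_sub]
    congr 1
    abel
  rw [LinearMap.sub_apply, LinearMap.sub_apply, Pi.sub_apply, inner_sub_left, B3Op116SourceForm.inner_propagatorK_dip_apply,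
    B3Op116SourceForm.inner_propagatorK_dip_apply, ← mul_sub, ← inner_sub_right, ← covDeriv_sub]

/-- `⟨z, z⟩ ≤ ‖z‖·c`, `c ≥ 0` ⟹ `‖z‖ ≤ c`. [folklore] -/
private theorem norm_le_of_inner_self_le'' {z : E N} {c : ℝ} (hc : 0 ≤ c) (h : ⟪z, z⟫_ℝ ≤ ‖z‖ * c) : ‖z‖ ≤ c := by
  rw [real_inner_self_eq_norm_sq, pow_two] at h
  by_cases hz0 : ‖z‖ = 0
  · rw [hz0]; exact hc
  · exact le_of_mul_le_mul_left h (lt_of_le_of_ne (norm_nonneg z) (Ne.symm hz0))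

/-- **The value of `W` on a dipole through the rows of `W`, on every `Ω`**: `‖(Wdip^{X′}_bY)(x)‖ ≤ ε‖Y‖Σ_i‖(D^ε_{X′}We_{(x,i)})(b)‖`.
[cite: Balaban1982Higgs1, (1.7) p.605, (2.20) p.610] -/
theorem norm_W_dip_apply_le (X' : HiggsLattice.VecField P 0) (b : HiggsLattice.PBond P 0) (Y : E N) (x : HiggsLattice.Site P 0) :
    ‖(propagatorK C Ω (A + B) msq a k - propagatorK C Ω B msq a k) (dip C X' b Y) x‖
      ≤ P.mesh 0 * ‖Y‖ * ∑ i : Ix N, ‖covDeriv C X'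
          ((propagatorK C Ω (A + B) msq a k - propagatorK C Ω B msq a k) (cb P N 0 (x, i))) b‖ := by
  have hS0 : 0 ≤ ∑ i : Ix N, ‖covDeriv C X'
      ((propagatorK C Ω (A + B) msq a k - propagatorK C Ω B msq a k) (cb P N 0 (x, i))) b‖ :=
    Finset.sum_nonneg fun _ _ => norm_nonneg _
  have hε : 0 < P.mesh 0 := P.mesh_pos 0
  refine norm_le_of_inner_self_le'' (by positivity) ?_
  rw [inner_W_dip_apply]
  calc P.mesh 0 * ⟪Y, covDeriv C X' ((propagatorK C Ω (A + B) msq a k - propagatorK C Ω B msq a k)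
          (Pi.single x ((propagatorK C Ω (A + B) msq a k - propagatorK C Ω B msq a k) (dip C X' b Y) x))) b⟫_ℝ
      ≤ P.mesh 0 * (‖Y‖ * ‖covDeriv C X' ((propagatorK C Ω (A + B) msq a k - propagatorK C Ω B msq a k)
          (Pi.single x ((propagatorK C Ω (A + B) msq a k - propagatorK C Ω B msq a k) (dip C X' b Y) x))) b‖) :=
        mul_le_mul_of_nonneg_left (real_inner_le_norm _ _) hε.le
    _ ≤ P.mesh 0 * (‖Y‖ * (‖(propagatorK C Ω (A + B) msq a k - propagatorK C Ω B msq a k) (dip C X' b Y) x‖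
          * ∑ i : Ix N, ‖covDeriv C X'
              ((propagatorK C Ω (A + B) msq a k - propagatorK C Ω B msq a k) (cb P N 0 (x, i))) b‖)) :=
        mul_le_mul_of_nonneg_left (mul_le_mul_of_nonneg_left
          (B3Ineq210MixedRegularTorus.norm_covDeriv_apply_single_le C X'
            (propagatorK C Ω (A + B) msq a k - propagatorK C Ω B msq a k) x _ b) (norm_nonneg _)) hε.le
    _ = _ := by ring

/-- **THE MIXED SEED ON A REGION, column side (value of `W` on the `B`-dipole at an interior bond, read at an interior site).**
`‖([G_k(Ω,Ã+B̃) − G_k(Ω,B̃)]dip^B_{b′}Y)(x)‖ ≤ ε‖Y‖·#Ix·(|e|s·K₁ + L^k|e|δ_A·K₂)·Σ_{j<k}(L^jε)^{2−d}exp(−(δ₁/(4L))(L^jε)^{−1}ε|b′₋ − x|)` with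
the torus constants of `B3Op116MixedSeed.value_W_dip_le` — by the symmetry of `W` and `deriv_W_single_le_region` at the row bond `b′`.
[cite: Balaban1983Higgs3, (1.16) p.414, (2.10) p.426, p.412] [cite: Balaban1982Higgs1, (2.20) p.610, (3.44) p.619] -/
theorem value_W_dip_le_region (hmsq : 0 < msq) (ha : 0 < a) (hk : 1 ≤ k) (hkK : k ≤ P.K) (hδ₁ : 0 < δ₁) (hδ₁1 : δ₁ ≤ 1)
    (hCst : 0 ≤ Cst) (hCM : 0 ≤ CM) (hs : 0 ≤ s) (hδA : 0 ≤ δA) (ht1 : P.mesh k * (|C.e| * s) ≤ 1)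
    (h210B : (regRegionKernels hL1 C Ω B msq a k K₀).Ineq210 δ₁ Cst)
    (hmixB : ∀ (j : ℕ) (μ ν : Fin P.d) (x x' : HiggsLattice.Site P 0), Interior k K₀ Ω x → Interior k K₀ Ω x' →
      mixedTermR C Ω B msq a k j μ ν x x' ≤ CM * (P.mesh j ^ P.d)⁻¹ * Real.exp (-(δ₁ * ((HiggsLattice.Site.tdist x x' : ℝ) / (P.L : ℝ) ^ j))))
    (h210AB : (regRegionKernels hL1 C Ω (A + B) msq a k K₀).Ineq210 δ₁ Cst)
    (hA : ∀ b : HiggsLattice.PBond P 0, |A b| ≤ s)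
    (hreg : ∀ (z : HiggsLattice.Site P 0) (μ ν : Fin P.d), |A ⟨z.shift ν, μ⟩ - A ⟨z, μ⟩| ≤ δA)
    (hAS : ∀ b : HiggsLattice.PBond P 0, A b ≠ 0 → DeepBlk k K₀ Ω b.src ∧ DeepBlk k K₀ Ω b.tgt)
    (i₀ : Ix N) {b' : HiggsLattice.PBond P 0} (hb' : Interior k K₀ Ω b'.src) (Y : E N) {x : HiggsLattice.Site P 0}
    (hx : Interior k K₀ Ω x) :
    ‖(propagatorK C Ω (A + B) msq a k - propagatorK C Ω B msq a k) (dip C B b' Y) x‖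
      ≤ P.mesh 0 * ‖Y‖ * ((Fintype.card (Ix N) : ℝ) *
        ((|C.e| * s * seedK1 P N δ₁ Cst CM a 2 (P.mesh 0 ^ P.d * Cst) ((P.mesh 0 ^ P.d * Cst) * (1 + Real.exp 1))
            + (P.L : ℝ) ^ k * (|C.e| * δA) * seedK2 P N δ₁ Cst 2 (P.mesh 0 ^ P.d * Cst)) *
          ∑ j ∈ Finset.range k, P.mesh j ^ ((2 : ℝ) - (P.d : ℝ)) *
            Real.exp (-(δ₁ / 2 / 2 / P.L * (P.mesh j)⁻¹ * (P.mesh 0 * (HiggsLattice.Site.tdist b'.src x : ℝ)))))) := by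
  refine (norm_W_dip_apply_le B b' Y x).trans (mul_le_mul_of_nonneg_left ?_ (mul_nonneg (P.mesh_pos 0).le (norm_nonneg _)))
  refine (Finset.sum_le_sum fun i _ =>
    deriv_W_single_le_region hmsq ha hk hkK hδ₁ hδ₁1 hCst hCM hs hδA ht1 h210B hmixB h210AB hA hreg hAS i₀ hb' hx i).trans (le_of_eq ?_)
  rw [Finset.sum_const, nsmul_eq_mul, Finset.card_univ]

/-- **THE MIXED SEED ON A REGION AS A STATE of file R2's induction** (`B3Op116DKernelRegularRegion.step_state_region`, state `J = 0`): for an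
INTERIOR dipole bond `b′`, the field `φ = [G_k(Ω,Ã+B̃) − G_k(Ω,B̃)]dip^B_{b′}Y` has VALUES below `𝔪_k(cv₀, 2; δ₀)(x, b′₋)` at interior `x` and
`D^ε_B`-DERIVATIVES below `𝔪_k(cd₀, 1; δ₀)(b₀₋, b′₋)` at bonds from interior `b₀₋`, `δ₀ = δ₁/(4L)`, with EXACTLY the torus constants `cv₀`,
`cd₀` of `B3Op116MixedSeed.mixed_seed_state`. [cite: Balaban1983Higgs3, (1.16) p.414, (2.6) p.424, (2.10) p.426, p.412] [cite: Balaban1982Higgs1, (3.16) p.615, (3.44) p.619] [cite: Balaban1983RegularityDecay, Theorem p.573] -/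
theorem mixed_seed_state_region (hmsq : 0 < msq) (ha : 0 < a) (hk : 1 ≤ k) (hkK : k ≤ P.K) (hδ₁ : 0 < δ₁) (hδ₁1 : δ₁ ≤ 1)
    (hCst : 0 ≤ Cst) (hCM : 0 ≤ CM) (hs : 0 ≤ s) (hδA : 0 ≤ δA) (ht1 : P.mesh k * (|C.e| * s) ≤ 1)
    (h210B : (regRegionKernels hL1 C Ω B msq a k K₀).Ineq210 δ₁ Cst)
    (hmixB : ∀ (j : ℕ) (μ ν : Fin P.d) (x x' : HiggsLattice.Site P 0), Interior k K₀ Ω x → Interior k K₀ Ω x' →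
      mixedTermR C Ω B msq a k j μ ν x x' ≤ CM * (P.mesh j ^ P.d)⁻¹ * Real.exp (-(δ₁ * ((HiggsLattice.Site.tdist x x' : ℝ) / (P.L : ℝ) ^ j))))
    (h210AB : (regRegionKernels hL1 C Ω (A + B) msq a k K₀).Ineq210 δ₁ Cst)
    (hmixAB : ∀ (j : ℕ) (μ ν : Fin P.d) (x x' : HiggsLattice.Site P 0), Interior k K₀ Ω x → Interior k K₀ Ω x' →
      mixedTermR C Ω (A + B) msq a k j μ ν x x'
        ≤ CM * (P.mesh j ^ P.d)⁻¹ * Real.exp (-(δ₁ * ((HiggsLattice.Site.tdist x x' : ℝ) / (P.L : ℝ) ^ j))))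
    (hA : ∀ b : HiggsLattice.PBond P 0, |A b| ≤ s)
    (hreg : ∀ (z : HiggsLattice.Site P 0) (μ ν : Fin P.d), |A ⟨z.shift ν, μ⟩ - A ⟨z, μ⟩| ≤ δA)
    (hAS : ∀ b : HiggsLattice.PBond P 0, A b ≠ 0 → DeepBlk k K₀ Ω b.src ∧ DeepBlk k K₀ Ω b.tgt)
    (i₀ : Ix N) {b' : HiggsLattice.PBond P 0} (hb' : Interior k K₀ Ω b'.src) (Y : E N) :
    (∀ x : HiggsLattice.Site P 0, Interior k K₀ Ω x →
      ‖(propagatorK C Ω (A + B) msq a k - propagatorK C Ω B msq a k) (dip C B b' Y) x‖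
        ≤ B3Op116MajorantStep.maj P k
            (P.mesh 0 * ‖Y‖ * (Fintype.card (Ix N) : ℝ) *
              (|C.e| * s * seedK1 P N δ₁ Cst CM a 2 (P.mesh 0 ^ P.d * Cst) ((P.mesh 0 ^ P.d * Cst) * (1 + Real.exp 1))
                + (P.L : ℝ) ^ k * (|C.e| * δA) * seedK2 P N δ₁ Cst 2 (P.mesh 0 ^ P.d * Cst)))
            2 (δ₁ / 2 / 2 / P.L) x b'.src) ∧
    (∀ b₀ : HiggsLattice.PBond P 0, Interior k K₀ Ω b₀.src →
      ‖covDeriv C B ((propagatorK C Ω (A + B) msq a k - propagatorK C Ω B msq a k) (dip C B b' Y)) b₀‖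
        ≤ B3Op116MajorantStep.maj P k
            (|C.e| * s * seedK1 P N δ₁ Cst CM a 1 (P.mesh 0 * ‖Y‖ * ((P.mesh 0 ^ P.d * Cst) * (1 + Real.exp 1)))
                (P.mesh 0 * ‖Y‖ * (P.mesh 0 ^ P.d * CM + (P.mesh 0 ^ P.d * Cst) * Real.exp 1
                  + (P.mesh 0 ^ P.d * Cst) * (1 + Real.exp 1) * Real.exp 1))
              + (P.L : ℝ) ^ k * (|C.e| * δA) * seedK2 P N δ₁ Cst 1 (P.mesh 0 * ‖Y‖ * ((P.mesh 0 ^ P.d * Cst) * (1 + Real.exp 1))))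
            1 (δ₁ / 2 / 2 / P.L) b₀.src b'.src) := by
  constructor
  · intro x hx
    refine (value_W_dip_le_region hmsq ha hk hkK hδ₁ hδ₁1 hCst hCM hs hδA ht1 h210B hmixB h210AB hA hreg hAS i₀ hb' Y hx).trans
      (le_of_eq ?_)
    rw [← mul_sumS_eq_maj, tdist_comm x b'.src]
    ring
  · intro b₀ hb₀
    refine (mixed_seed_le_region hmsq ha hk hkK hδ₁ hδ₁1 hCst hCM hs hδA ht1 h210B hmixB h210AB hmixAB hA hreg hAS i₀ hb₀ hb' Y).trans
      (le_of_eq ?_)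
    rw [← mul_sumS_eq_maj]

end Instances

end Literature.MathematicalPhysics.QuantumFieldTheory.Balaban1983to89.B3Op116MixedSeedRegion

end
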